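import Mathlib
import Literature.NumberTheory.Transcendental.OddZetaSeries
import HarnessLib

/-!
# Odd zeta values III: sampling estimates for the twisted Ball–Rivoal series

Analytic half of an elementary proof that infinitely many of `ζ(3), ζ(5), ζ(7), …` are
irrational (this tree's `infinite_setOf_irrational_zetaValue_odd`, **periods.S19**-Corollary of
`PeriodsWave0.lean`; Rivoal 2000, Ball–Rivoal 2001), for the rational function already in the
tree: `OddZeta.Rfun r D s n` of `OddZetaSeries.lean` ("Odd zeta values II"; the
Ball–Rivoal / Fischler–Sprang–Zudilin function with Sprang's twists,
`R_n(t) = D^L n!^{s+1-(2r+1)D} ∏_{l ≤ L} (t - rn + l/D) / ∏_{k ≤ n} (t+k)^{s+1}`, `L = (2r+1)Dn`),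
whose arithmetic (`OddZeta.isExp_Rfun`, `OddZeta.exists_symm_exp`, `OddZeta.linear_forms`) is
proved there. We follow the elementary line of Zudilin (2018) and Sprang (2018) /
Fischler–Sprang–Zudilin (2019): the linear forms are sums of the values of `R_n` over the
lattices `(1/d)ℕ`, `d ∣ D` ("higher twists"), and unwanted odd zeta values are eliminated between
the different `d` [cite: Sprang2018OddZeta, §1 and §3]. The one non-elementary-looking step of
that line is the comparison of the twisted sums for different `d` (Sprang 2018, Lemma 2.1:
`r_n^{(D,j)}/r_n^{(D,j')} → 1`, via Stirling's formula and a de Bruijn-type concentration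
argument). This file replaces it by a sampling argument using only first-year calculus:

* on `(rn, ∞)` (beyond the last zero): `R_n = exp ψ`, `ψ' = φ₁`, `φ₁' = φ₂` (`hasDerivAt_R`, …),
  the crude bound `R_n(t) ≤ D^L (r+2)^{L+1} r^{-n(s+1-(2r+1)D)} t^{-s}` (`R_le`),
  `φ₁ ≥ D log(t/(t-rn)) - (s+1)(n+1)/t` (`φ₁_lower`: keep the `Drn` factors with zeros in
  `(0, rn]`, use `1/y ≥ D (log(y+1/D) - log y)` and telescope) and `|φ₁| ≤ C₁`,
  `|φ₂| ≤ c₂ ≍ 1/n` beyond `T₀ = rn + u`, `u = ⌊n/K⌋ + 1` (`abs_φ₁_le`, `abs_φ₂_le`);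
* hence `φ₁ ≥ 1` on the window `(rn, rn+3u]` once `1 + 2(s+1)/r ≤ D log(rK/6)`
  (`one_le_φ₁_of_window`), so `R_n` grows at least like `e^t` there (`R_growth`) and the
  samples below `T₀` are negligible; the samples `m/d ≤ rn` vanish (`R_sample_eq_zero`);
* the Riemann sums `PS d X = (1/d) ∑_{m ≤ dX} R_n(m/d)` satisfy
  `|PS d X - ∫_{T₀}^X R_n| ≤ e^{-u} ∫ R_n + ∫ |R_n'|` (`abs_PS_sub_integral_le`, cell by cell),
  and the total variation is small *relative to the mass*:
  `∫|R_n'| = ∫ R_n|φ₁| ≤ (λ∫R_n + λ⁻¹∫R_nφ₁²)/2` (AM–GM, `integral_abs_deriv_le`) with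
  `∫ R_n φ₁² = ∫ R_n' φ₁ = [R_nφ₁] - ∫ R_n φ₂ ≤ C₁ R_n(X) + c₂ ∫ R_n` (integration by parts,
  `integral_R_mul_sq_le`; the boundary term at `T₀` has the good sign because `φ₁(T₀) ≥ 1`),
  whence with `λ = √c₂`: `∫|R_n'| ≤ √c₂ ∫R_n + O(R_n(X))` (`tv_le`);
* letting `X → ∞`: the series `S d = (1/d) ∑_{m≥1} R_n(m/d)` (`S`, `summable_term`) satisfy
  `|S d - S d'| ≤ 4 ε_n S D`, `ε_n = e^{-u} + √c₂ → 0` (`abs_S_sub_S_le`, `tendsto_ε`,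
  `eventually_abs_S_sub_S_le`), together with `S D > 0` (`S_pos`) and
  `S d ≤ 2 Cₙ D^s`, `Cₙ = D^L (r+2)^{L+1} r^{-n(s+1-(2r+1)D)}` (`S_le`).

Since `∑_{m ≥ 1} R_n(m/d) = ∑_{j'=1}^{d} ∑_{m ≥ 0} R_n(m + j'/d)`, these `d`-sums are sums of the
`j`-shifted series of `OddZeta.linear_forms` over `(D/d) ∣ j`; the elimination and the final
step are in the sequel. Design: all parameters are natural numbers, every constant is explicit,
the hypotheses are those of `OddZetaSeries` (`0 < D`, `1 ≤ r`, `(2r+1)D + 2 ≤ s+1`); nothing here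
is a named fact. What is NOT here: any asymptotic *equivalent* for the linear forms.

## References
* [Sprang2018OddZeta] J. Sprang, Infinitely many odd zeta values are irrational. By elementary
  means, arXiv:1802.09410 (2018), §§1–3 (Lemma 2.1 is the step replaced here).
* [Zudilin2018OddZeta] W. Zudilin, One of the odd zeta values from `ζ(5)` to `ζ(25)` is
  irrational. By elementary means, SIGMA 14 (2018) 028.
* [FischlerSprangZudilin2019] S. Fischler, J. Sprang, W. Zudilin, Many odd zeta values are
  irrational, Compositio Math. 155 (2019) 938–952, §2 and Remark 1 (the parameter `r`).
* [Rivoal2000] T. Rivoal, C. R. Acad. Sci. Paris 331 (2000) 267–270.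
-/

noncomputable section

open Finset Real

open scoped Nat

namespace Literature.NumberTheory.Transcendental

namespace OddZetaSampling

open OddZeta

variable {r D s n : ℕ}

/-- `ψ = log R_n` on `(rn, ∞)`:
`ψ(t) = L log D + (s+1-(2r+1)D) log n! + ∑_{l ≤ L} log(t - rn + l/D) - (s+1) ∑_{k ≤ n} log(t+k)`.
[folklore] -/
def ψ (r D s n : ℕ) (t : ℝ) : ℝ :=
  (Lnum r D n : ℝ) * Real.log D + ((s + 1 - (2 * r + 1) * D : ℕ) : ℝ) * Real.log (n !) +
    ∑ l ∈ range (Lnum r D n + 1), Real.log (t - r * n + (l : ℝ) / D) -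
    ((s : ℝ) + 1) * ∑ k ∈ range (n + 1), Real.log (t + k)

/-- `φ₁ = ψ' = R_n'/R_n`. [folklore] -/
def φ₁ (r D s n : ℕ) (t : ℝ) : ℝ :=
  ∑ l ∈ range (Lnum r D n + 1), 1 / (t - r * n + (l : ℝ) / D) -
    ((s : ℝ) + 1) * ∑ k ∈ range (n + 1), 1 / (t + k)

/-- `φ₂ = φ₁'`. [folklore] -/
def φ₂ (r D s n : ℕ) (t : ℝ) : ℝ :=
  -∑ l ∈ range (Lnum r D n + 1), 1 / (t - r * n + (l : ℝ) / D) ^ 2 +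
    ((s : ℝ) + 1) * ∑ k ∈ range (n + 1), 1 / (t + k) ^ 2

/-- `rn ≥ 0`. [folklore] -/
theorem rn_nonneg : (0 : ℝ) ≤ (r : ℝ) * n := by positivity

/-- `t > rn` implies `t > 0`. [folklore] -/
theorem pos_of_gt {t : ℝ} (ht : (r : ℝ) * n < t) : 0 < t := lt_of_le_of_lt rn_nonneg ht

/-- `t + k > 0` for `t > 0`. [folklore] -/
theorem add_nat_pos {t : ℝ} (ht : 0 < t) (k : ℕ) : 0 < t + k := by positivity

/-- The numerator factors `t - rn + l/D` are positive for `t > rn`. [folklore] -/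
theorem factor_pos (l : ℕ) {t : ℝ} (ht : (r : ℝ) * n < t) : 0 < t - r * n + (l : ℝ) / D := by
  have : (0 : ℝ) ≤ (l : ℝ) / D := by positivity
  linarith

/-- The numerator factors are at most `(r+2) t` for `t > rn`, `r ≥ 1`, `l ≤ L`. [folklore] -/
theorem factor_le (hD : 0 < D) (hr : 1 ≤ r) {l : ℕ} (hl : l < Lnum r D n + 1) {t : ℝ}
    (ht : (r : ℝ) * n < t) : t - r * n + (l : ℝ) / D ≤ ((r : ℝ) + 2) * t := by
  have hD' : (0 : ℝ) < D := by exact_mod_cast hD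
  have hr' : (1 : ℝ) ≤ r := by exact_mod_cast hr
  have hl' : (l : ℝ) / D ≤ (2 * r + 1) * n := by
    rw [div_le_iff₀ hD']
    have : (l : ℝ) ≤ (Lnum r D n : ℕ) := by exact_mod_cast Nat.lt_succ_iff.mp hl
    unfold Lnum at this; push_cast at this
    linarith
  have hn : (n : ℝ) ≤ t := by
    have : (n : ℝ) ≤ r * n := by nlinarith [(Nat.cast_nonneg n : (0 : ℝ) ≤ n)]
    linarith
  have ht0 := pos_of_gt ht
  nlinarith

/-- `R_n(t) > 0` for `t > rn`. [folklore] -/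
theorem R_pos (hD : 0 < D) {t : ℝ} (ht : (r : ℝ) * n < t) : 0 < Rfun r D s n t := by
  unfold Rfun
  have ht0 := pos_of_gt ht
  have hD' : (0 : ℝ) < D := by exact_mod_cast hD
  apply div_pos
  · apply mul_pos
    · have : (0 : ℝ) < n ! := by exact_mod_cast n.factorial_pos
      positivity
    · exact prod_pos fun l _ => factor_pos l ht
  · exact prod_pos fun k _ => pow_pos (add_nat_pos ht0 k) _

/-- `log R_n = ψ` on `(rn, ∞)`. [folklore] -/
theorem log_R (hD : 0 < D) {t : ℝ} (ht : (r : ℝ) * n < t) :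
    Real.log (Rfun r D s n t) = ψ r D s n t := by
  have ht0 := pos_of_gt ht
  have hD' : (0 : ℝ) < D := by exact_mod_cast hD
  have hfac : (0 : ℝ) < n ! := by exact_mod_cast n.factorial_pos
  have hP : ∀ l ∈ range (Lnum r D n + 1), t - r * n + (l : ℝ) / D ≠ 0 :=
    fun l _ => (factor_pos l ht).ne'
  have hQ : ∀ k ∈ range (n + 1), (t + (k : ℝ)) ^ (s + 1) ≠ 0 :=
    fun k _ => pow_ne_zero _ (add_nat_pos ht0 k).ne'
  have hPne : ∏ l ∈ range (Lnum r D n + 1), (t - r * n + (l : ℝ) / D) ≠ 0 :=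
    prod_ne_zero_iff.mpr hP
  have hQne : ∏ k ∈ range (n + 1), (t + (k : ℝ)) ^ (s + 1) ≠ 0 := prod_ne_zero_iff.mpr hQ
  have hDL : (D : ℝ) ^ Lnum r D n ≠ 0 := pow_ne_zero _ hD'.ne'
  have hfk : (n ! : ℝ) ^ (s + 1 - (2 * r + 1) * D) ≠ 0 := pow_ne_zero _ hfac.ne'
  unfold Rfun ψ
  rw [Real.log_div (mul_ne_zero (mul_ne_zero hDL hfk) hPne) hQne,
    Real.log_mul (mul_ne_zero hDL hfk) hPne, Real.log_mul hDL hfk, Real.log_pow, Real.log_pow,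
    Real.log_prod hP, Real.log_prod hQ]
  have : ∑ k ∈ range (n + 1), Real.log ((t + (k : ℝ)) ^ (s + 1)) =
      ((s : ℝ) + 1) * ∑ k ∈ range (n + 1), Real.log (t + k) := by
    rw [mul_sum]
    refine sum_congr rfl fun k _ => ?_
    rw [Real.log_pow]; push_cast; ring
  rw [this]

/-- `R_n = exp ψ` on `(rn, ∞)`. [folklore] -/
theorem R_eq_exp (hD : 0 < D) {t : ℝ} (ht : (r : ℝ) * n < t) :
    Rfun r D s n t = Real.exp (ψ r D s n t) := by
  rw [← log_R hD ht, Real.exp_log (R_pos hD ht)]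

/-- `ψ' = φ₁` on `(rn, ∞)`. [folklore] -/
theorem hasDerivAt_ψ {t : ℝ} (ht : (r : ℝ) * n < t) :
    HasDerivAt (ψ r D s n) (φ₁ r D s n t) t := by
  have ht0 := pos_of_gt ht
  have h1 : ∀ l ∈ range (Lnum r D n + 1),
      HasDerivAt (fun t => Real.log (t - r * n + (l : ℝ) / D)) (1 / (t - r * n + (l : ℝ) / D)) t := by
    intro l _
    have ha : HasDerivAt (fun t : ℝ => t - r * n + (l : ℝ) / D) 1 t :=
      ((hasDerivAt_id' t).sub_const _).add_const _
    exact ha.log (factor_pos l ht).ne'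
  have h2 : ∀ k ∈ range (n + 1),
      HasDerivAt (fun t => Real.log (t + (k : ℝ))) (1 / (t + k)) t := by
    intro k _
    exact ((hasDerivAt_id' t).add_const _).log (add_nat_pos ht0 k).ne'
  have hs1 := HasDerivAt.fun_sum h1
  have hs2 := HasDerivAt.fun_sum h2
  exact (hs1.const_add ((Lnum r D n : ℝ) * Real.log D +
    ((s + 1 - (2 * r + 1) * D : ℕ) : ℝ) * Real.log (n !))).sub (hs2.const_mul ((s : ℝ) + 1))

/-- `φ₁' = φ₂` on `(rn, ∞)`. [folklore] -/
theorem hasDerivAt_φ₁ {t : ℝ} (ht : (r : ℝ) * n < t) :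
    HasDerivAt (φ₁ r D s n) (φ₂ r D s n t) t := by
  have ht0 := pos_of_gt ht
  have h1 : ∀ l ∈ range (Lnum r D n + 1),
      HasDerivAt (fun t => 1 / (t - r * n + (l : ℝ) / D)) (-(1 / (t - r * n + (l : ℝ) / D) ^ 2)) t := by
    intro l _
    have ha : HasDerivAt (fun t : ℝ => t - r * n + (l : ℝ) / D) 1 t :=
      ((hasDerivAt_id' t).sub_const _).add_const _
    have := ha.inv (factor_pos l ht).ne'
    simp only [one_div]
    refine this.congr_deriv ?_
    ring
  have h2 : ∀ k ∈ range (n + 1),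
      HasDerivAt (fun t => 1 / (t + (k : ℝ))) (-(1 / (t + k) ^ 2)) t := by
    intro k _
    have := ((hasDerivAt_id' t).add_const (k : ℝ)).inv (add_nat_pos ht0 k).ne'
    simp only [one_div]
    refine this.congr_deriv ?_
    ring
  have hs1 := HasDerivAt.fun_sum h1
  have hs2 := HasDerivAt.fun_sum h2
  have := hs1.sub (hs2.const_mul ((s : ℝ) + 1))
  refine this.congr_deriv ?_
  simp only [φ₂, sum_neg_distrib, mul_neg]
  ring

/-- `R_n' = R_n φ₁` on `(rn, ∞)`. [folklore] -/
theorem hasDerivAt_R (hD : 0 < D) {t : ℝ} (ht : (r : ℝ) * n < t) :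
    HasDerivAt (Rfun r D s n) (Rfun r D s n t * φ₁ r D s n t) t := by
  have h := (hasDerivAt_ψ (D := D) (s := s) ht).exp
  have heq : (fun x => Real.exp (ψ r D s n x)) =ᶠ[nhds t] Rfun r D s n := by
    filter_upwards [Ioi_mem_nhds ht] with x hx
    exact (R_eq_exp hD hx).symm
  rw [R_eq_exp hD ht]
  exact h.congr_of_eventuallyEq heq.symm

/-- `R_n` is continuous on `(rn, ∞)`. [folklore] -/
theorem continuousAt_R (hD : 0 < D) {t : ℝ} (ht : (r : ℝ) * n < t) :
    ContinuousAt (Rfun r D s n) t := (hasDerivAt_R (s := s) hD ht).continuousAt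

/-- `φ₁` is continuous on `(rn, ∞)`. [folklore] -/
theorem continuousAt_φ₁ {t : ℝ} (ht : (r : ℝ) * n < t) :
    ContinuousAt (φ₁ r D s n) t := (hasDerivAt_φ₁ (D := D) (s := s) ht).continuousAt

/-! ### Vanishing and sign at the sample points `m/d`, `d ∣ D` -/

/-- `R_n(m/d) = 0` for `d ∣ D` and `1 ≤ m ≤ d r n`: `m/d = rn - l/D` with `l = Drn - mD/d ≤ L`.
[folklore] -/
theorem R_sample_eq_zero {d m : ℕ} (hd : d ∣ D) (hD : 0 < D) (hm : m ≤ d * r * n) :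
    Rfun r D s n ((m : ℝ) / d) = 0 := by
  obtain ⟨e, he⟩ := hd
  have hdpos : 0 < d := Nat.pos_of_ne_zero fun h => by simp [h] at he; omega
  have hepos : 0 < e := Nat.pos_of_ne_zero fun h => by simp [h] at he; omega
  have hme : m * e ≤ D * r * n := by
    calc m * e ≤ d * r * n * e := Nat.mul_le_mul_right e hm
      _ = D * r * n := by rw [he]; ring
  have hl : D * r * n - m * e < Lnum r D n + 1 := by
    unfold Lnum
    have : D * r * n ≤ (2 * r + 1) * D * n := by nlinarith
    omega
  have hfac : ((m : ℝ) / d - r * n + (((D * r * n - m * e : ℕ)) : ℝ) / D) = 0 := by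
    rw [Nat.cast_sub hme, he]
    have hd' : (d : ℝ) ≠ 0 := by exact_mod_cast hdpos.ne'
    have he' : (e : ℝ) ≠ 0 := by exact_mod_cast hepos.ne'
    push_cast
    field_simp
    ring
  unfold Rfun
  rw [prod_eq_zero (mem_range.mpr hl) hfac, mul_zero, zero_div]

/-- `R_n(m/d) ≥ 0` at every sample point `m/d`, `d ∣ D`. [folklore] -/
theorem R_sample_nonneg {d : ℕ} (hd : d ∣ D) (hD : 0 < D) (m : ℕ) :
    0 ≤ Rfun r D s n ((m : ℝ) / d) := by
  rcases le_or_gt m (d * r * n) with h | h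
  · rw [R_sample_eq_zero hd hD h]
  · have hdpos : 0 < d := Nat.pos_of_dvd_of_pos hd hD
    have hd' : (0 : ℝ) < d := by exact_mod_cast hdpos
    refine (R_pos hD ?_).le
    rw [lt_div_iff₀ hd']
    have : ((d * r * n : ℕ) : ℝ) < m := by exact_mod_cast h
    push_cast at this
    linarith

/-! ### Crude pointwise upper bound -/

/-- For `t > rn` (`r ≥ 1`, `(2r+1)D ≤ s+1`):
`R_n(t) ≤ D^L (r+2)^{L+1} / (r^{n(s+1-(2r+1)D)} t^s)`
(each numerator factor is `≤ (r+2)t`, `∏ (t+k)^{s+1} ≥ t^{(n+1)(s+1)}`, `n! ≤ nⁿ`, `rn ≤ t`).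
[folklore] -/
theorem R_le (hD : 0 < D) (hr : 1 ≤ r) (hs : (2 * r + 1) * D ≤ s + 1) {t : ℝ}
    (ht : (r : ℝ) * n < t) :
    Rfun r D s n t ≤ (D : ℝ) ^ Lnum r D n * ((r : ℝ) + 2) ^ (Lnum r D n + 1) /
      ((r : ℝ) ^ (n * (s + 1 - (2 * r + 1) * D)) * t ^ s) := by
  set k := s + 1 - (2 * r + 1) * D with hk
  set L := Lnum r D n with hL
  have hsk : (n + 1) * (s + 1) = n * k + (L + 1 + s) := by
    have h1 : s + 1 = k + (2 * r + 1) * D := by omega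
    have h2 : L = (2 * r + 1) * D * n := rfl
    rw [h2, h1]
    have : k + (2 * r + 1) * D - 1 = k + ((2 * r + 1) * D - 1) := by
      have : 1 ≤ (2 * r + 1) * D := Nat.one_le_iff_ne_zero.mpr (Nat.mul_ne_zero (by omega) hD.ne')
      omega
    nlinarith [this]
  have ht0 := pos_of_gt ht
  have hr0 : (0 : ℝ) < r := by exact_mod_cast hr
  have hD' : (0 : ℝ) < D := by exact_mod_cast hD
  -- numerator bound
  have hnum : ∏ l ∈ range (L + 1), (t - r * n + (l : ℝ) / D) ≤ (((r : ℝ) + 2) * t) ^ (L + 1) := by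
    have : ∏ l ∈ range (L + 1), (t - r * n + (l : ℝ) / D) ≤ ∏ _l ∈ range (L + 1), (((r : ℝ) + 2) * t) :=
      prod_le_prod (fun l _ => (factor_pos l ht).le) fun l hl => factor_le hD hr (mem_range.mp hl) ht
    simpa [prod_const, card_range] using this
  -- denominator bound
  have hden : (t ^ (s + 1)) ^ (n + 1) ≤ ∏ j ∈ range (n + 1), (t + (j : ℝ)) ^ (s + 1) := by
    have : ∏ _j ∈ range (n + 1), t ^ (s + 1) ≤ ∏ j ∈ range (n + 1), (t + (j : ℝ)) ^ (s + 1) :=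
      prod_le_prod (fun j _ => by positivity) fun j _ =>
        pow_le_pow_left₀ ht0.le (le_add_of_nonneg_right (by positivity)) _
    simpa [prod_const, card_range] using this
  have hQpos : 0 < ∏ j ∈ range (n + 1), (t + (j : ℝ)) ^ (s + 1) :=
    prod_pos fun j _ => pow_pos (add_nat_pos ht0 j) _
  have hfac : (0 : ℝ) < n ! := by exact_mod_cast n.factorial_pos
  -- `n! rⁿ ≤ tⁿ`
  have hfac_le : (n ! : ℝ) * (r : ℝ) ^ n ≤ t ^ n := by
    have h1 : (n ! : ℝ) ≤ (n : ℝ) ^ n := by exact_mod_cast Nat.factorial_le_pow n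
    have h2 : ((r : ℝ) * n) ^ n ≤ t ^ n := pow_le_pow_left₀ rn_nonneg ht.le n
    calc (n ! : ℝ) * (r : ℝ) ^ n ≤ (n : ℝ) ^ n * (r : ℝ) ^ n :=
          mul_le_mul_of_nonneg_right h1 (by positivity)
      _ = ((r : ℝ) * n) ^ n := by rw [mul_pow]; ring
      _ ≤ t ^ n := h2
  have hfac_le' : (n ! : ℝ) ^ k * (r : ℝ) ^ (n * k) ≤ t ^ (n * k) := by
    have h := pow_le_pow_left₀ (by positivity) hfac_le k
    rw [mul_pow] at h
    rw [pow_mul, pow_mul]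
    exact h
  -- assemble
  unfold Rfun
  rw [← hk, ← hL, div_le_div_iff₀ hQpos (by positivity)]
  calc (D : ℝ) ^ L * (n ! : ℝ) ^ k * (∏ l ∈ range (L + 1), (t - r * n + (l : ℝ) / D)) *
        ((r : ℝ) ^ (n * k) * t ^ s)
      ≤ (D : ℝ) ^ L * (n ! : ℝ) ^ k * (((r : ℝ) + 2) * t) ^ (L + 1) * ((r : ℝ) ^ (n * k) * t ^ s) := by
        gcongr
    _ = (D : ℝ) ^ L * ((r : ℝ) + 2) ^ (L + 1) * ((n ! : ℝ) ^ k * (r : ℝ) ^ (n * k)) *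
          t ^ (L + 1 + s) := by
        rw [mul_pow, pow_add]; ring
    _ ≤ (D : ℝ) ^ L * ((r : ℝ) + 2) ^ (L + 1) * t ^ (n * k) * t ^ (L + 1 + s) := by
        gcongr
    _ = (D : ℝ) ^ L * ((r : ℝ) + 2) ^ (L + 1) * (t ^ (s + 1)) ^ (n + 1) := by
        rw [← pow_mul, mul_comm (s + 1) (n + 1), hsk, pow_add]; ring
    _ ≤ (D : ℝ) ^ L * ((r : ℝ) + 2) ^ (L + 1) * ∏ j ∈ range (n + 1), (t + (j : ℝ)) ^ (s + 1) := by
        gcongr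

/-! ### Bounds for `φ₁`, `φ₂` -/

/-- `∑_{k ≤ n} 1/(t+k) ≤ (n+1)/t` for `t > 0`. [folklore] -/
theorem sum_inv_add_le {t : ℝ} (ht : 0 < t) :
    ∑ k ∈ range (n + 1), 1 / (t + (k : ℝ)) ≤ ((n : ℝ) + 1) / t := by
  have : ∀ k ∈ range (n + 1), 1 / (t + (k : ℝ)) ≤ 1 / t := fun k _ =>
    one_div_le_one_div_of_le ht (le_add_of_nonneg_right (by positivity))
  calc ∑ k ∈ range (n + 1), 1 / (t + (k : ℝ)) ≤ ∑ _k ∈ range (n + 1), 1 / t := sum_le_sum this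
    _ = ((n : ℝ) + 1) / t := by simp [card_range]; ring

/-- The key lower bound near the last zero: for `t > rn`,
`φ₁(t) ≥ D (log t - log(t-rn)) - (s+1)(n+1)/t` (keep only the `Drn` numerator factors with
zeros in `(0, rn]`, use `1/y ≥ D (log(y+1/D) - log y)` and telescope). [folklore] -/
theorem φ₁_lower (hD : 0 < D) {t : ℝ} (ht : (r : ℝ) * n < t) :
    (D : ℝ) * (Real.log t - Real.log (t - r * n)) - ((s : ℝ) + 1) * (((n : ℝ) + 1) / t) ≤
      φ₁ r D s n t := by
  have ht0 := pos_of_gt ht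
  have hD' : (0 : ℝ) < D := by exact_mod_cast hD
  set g : ℕ → ℝ := fun l => Real.log (t - r * n + (l : ℝ) / D) with hg
  have hstep : ∀ l ∈ range (D * r * n), (D : ℝ) * (g (l + 1) - g l) ≤ 1 / (t - r * n + (l : ℝ) / D) := by
    intro l _
    have hg1 : g (l + 1) = Real.log ((t - r * n + (l : ℝ) / D) + 1 / D) := by
      simp only [hg]; push_cast; ring_nf
    have hg0 : g l = Real.log (t - r * n + (l : ℝ) / D) := rfl
    rw [hg1, hg0]
    set y := t - r * n + (l : ℝ) / D with hy_def
    have hy : 0 < y := factor_pos l ht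
    have hpos' : 0 < y + 1 / D := by positivity
    have hlog : Real.log ((y + 1 / D) / y) ≤ (y + 1 / D) / y - 1 :=
      Real.log_le_sub_one_of_pos (by positivity)
    rw [Real.log_div hpos'.ne' hy.ne'] at hlog
    have h2 : (y + 1 / D) / y - 1 = (1 / D) * (1 / y) := by
      field_simp; ring
    rw [h2] at hlog
    calc (D : ℝ) * (Real.log (y + 1 / D) - Real.log y)
        ≤ (D : ℝ) * ((1 / D) * (1 / y)) := mul_le_mul_of_nonneg_left hlog hD'.le
      _ = 1 / y := by field_simp
  have htel : ∑ l ∈ range (D * r * n), (D : ℝ) * (g (l + 1) - g l) =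
      (D : ℝ) * (Real.log t - Real.log (t - r * n)) := by
    rw [← mul_sum, sum_range_sub]
    congr 1
    simp only [hg]
    push_cast
    have : t - (r : ℝ) * n + (D : ℝ) * r * n / D = t := by field_simp; ring
    rw [this, zero_div, add_zero]
  have hsub : range (D * r * n) ⊆ range (Lnum r D n + 1) := by
    refine range_subset_range.mpr ?_
    unfold Lnum
    calc D * r * n ≤ D * r * n + ((r + 1) * D * n + 1) := Nat.le_add_right _ _
      _ = (2 * r + 1) * D * n + 1 := by ring
  have hzero : (D : ℝ) * (Real.log t - Real.log (t - r * n)) ≤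
      ∑ l ∈ range (Lnum r D n + 1), 1 / (t - r * n + (l : ℝ) / D) := by
    rw [← htel]
    refine (sum_le_sum hstep).trans ?_
    exact sum_le_sum_of_subset_of_nonneg hsub fun l _ _ => (one_div_pos.mpr (factor_pos l ht)).le
  have hpole := sum_inv_add_le (n := n) ht0
  have hs0 : (0 : ℝ) ≤ (s : ℝ) + 1 := by positivity
  unfold φ₁
  nlinarith [mul_le_mul_of_nonneg_left hpole hs0]

/-- Upper bound `|φ₁(t)| ≤ (L+1)/v + (s+1)(n+1)/t` for `t ≥ rn + v`, `v > 0`. [folklore] -/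
theorem abs_φ₁_le {t v : ℝ} (hv : 0 < v) (ht : (r : ℝ) * n + v ≤ t) :
    |φ₁ r D s n t| ≤ ((Lnum r D n : ℝ) + 1) / v + ((s : ℝ) + 1) * ((n : ℝ) + 1) / t := by
  have ht' : (r : ℝ) * n < t := by linarith
  have ht0 := pos_of_gt ht'
  have h1 : ∀ l ∈ range (Lnum r D n + 1), 1 / (t - r * n + (l : ℝ) / D) ≤ 1 / v := by
    intro l _
    have : (0 : ℝ) ≤ (l : ℝ) / D := by positivity
    exact one_div_le_one_div_of_le hv (by linarith)
  have hA : ∑ l ∈ range (Lnum r D n + 1), 1 / (t - r * n + (l : ℝ) / D) ≤ ((Lnum r D n : ℝ) + 1) / v := by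
    calc ∑ l ∈ range (Lnum r D n + 1), 1 / (t - r * n + (l : ℝ) / D)
        ≤ ∑ _l ∈ range (Lnum r D n + 1), 1 / v := sum_le_sum h1
      _ = ((Lnum r D n : ℝ) + 1) / v := by simp [card_range]; ring
  have hA0 : 0 ≤ ∑ l ∈ range (Lnum r D n + 1), 1 / (t - r * n + (l : ℝ) / D) :=
    sum_nonneg fun l _ => (one_div_pos.mpr (factor_pos l ht')).le
  have hB := sum_inv_add_le (n := n) ht0
  have hB0 : 0 ≤ ∑ k ∈ range (n + 1), 1 / (t + (k : ℝ)) :=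
    sum_nonneg fun k _ => (one_div_pos.mpr (add_nat_pos ht0 k)).le
  have hs0 : (0 : ℝ) ≤ (s : ℝ) + 1 := by positivity
  have hY := mul_le_mul_of_nonneg_left hB hs0
  have hYZ : ((s : ℝ) + 1) * (((n : ℝ) + 1) / t) = ((s : ℝ) + 1) * ((n : ℝ) + 1) / t := by ring
  have hP : 0 ≤ ((Lnum r D n : ℝ) + 1) / v := by positivity
  have hX : 0 ≤ ((s : ℝ) + 1) * ∑ k ∈ range (n + 1), 1 / (t + (k : ℝ)) := mul_nonneg hs0 hB0
  have hZ : 0 ≤ ((s : ℝ) + 1) * ((n : ℝ) + 1) / t := by positivity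
  unfold φ₁
  rw [abs_le]
  constructor <;> linarith

/-- Upper bound `|φ₂(t)| ≤ (L+1)/v² + (s+1)(n+1)/t²` for `t ≥ rn + v`, `v > 0`. [folklore] -/
theorem abs_φ₂_le {t v : ℝ} (hv : 0 < v) (ht : (r : ℝ) * n + v ≤ t) :
    |φ₂ r D s n t| ≤ ((Lnum r D n : ℝ) + 1) / v ^ 2 + ((s : ℝ) + 1) * ((n : ℝ) + 1) / t ^ 2 := by
  have ht' : (r : ℝ) * n < t := by linarith
  have ht0 := pos_of_gt ht'
  have h1 : ∀ l ∈ range (Lnum r D n + 1), 1 / (t - r * n + (l : ℝ) / D) ^ 2 ≤ 1 / v ^ 2 := by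
    intro l _
    have : (0 : ℝ) ≤ (l : ℝ) / D := by positivity
    exact one_div_le_one_div_of_le (by positivity) (pow_le_pow_left₀ hv.le (by linarith) 2)
  have h3 : ∀ k ∈ range (n + 1), 1 / (t + (k : ℝ)) ^ 2 ≤ 1 / t ^ 2 := by
    intro k _
    exact one_div_le_one_div_of_le (by positivity)
      (pow_le_pow_left₀ ht0.le (le_add_of_nonneg_right (by positivity)) 2)
  have eA : ∑ l ∈ range (Lnum r D n + 1), 1 / (t - r * n + (l : ℝ) / D) ^ 2 ≤
      ((Lnum r D n : ℝ) + 1) / v ^ 2 := by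
    calc ∑ l ∈ range (Lnum r D n + 1), 1 / (t - r * n + (l : ℝ) / D) ^ 2
        ≤ ∑ _l ∈ range (Lnum r D n + 1), 1 / v ^ 2 := sum_le_sum h1
      _ = ((Lnum r D n : ℝ) + 1) / v ^ 2 := by simp [card_range]; ring
  have eA0 : 0 ≤ ∑ l ∈ range (Lnum r D n + 1), 1 / (t - r * n + (l : ℝ) / D) ^ 2 :=
    sum_nonneg fun l _ => by positivity
  have eB : ∑ k ∈ range (n + 1), 1 / (t + (k : ℝ)) ^ 2 ≤ ((n : ℝ) + 1) / t ^ 2 := by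
    calc ∑ k ∈ range (n + 1), 1 / (t + (k : ℝ)) ^ 2 ≤ ∑ _k ∈ range (n + 1), 1 / t ^ 2 := sum_le_sum h3
      _ = ((n : ℝ) + 1) / t ^ 2 := by simp [card_range]; ring
  have eB0 : 0 ≤ ∑ k ∈ range (n + 1), 1 / (t + (k : ℝ)) ^ 2 := sum_nonneg fun k _ => by positivity
  have hs0 : (0 : ℝ) ≤ (s : ℝ) + 1 := by positivity
  have hY := mul_le_mul_of_nonneg_left eB hs0
  have hYZ : ((s : ℝ) + 1) * (((n : ℝ) + 1) / t ^ 2) = ((s : ℝ) + 1) * ((n : ℝ) + 1) / t ^ 2 := by ring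
  have hP : 0 ≤ ((Lnum r D n : ℝ) + 1) / v ^ 2 := by positivity
  have hX : 0 ≤ ((s : ℝ) + 1) * ∑ k ∈ range (n + 1), 1 / (t + (k : ℝ)) ^ 2 := mul_nonneg hs0 eB0
  have hZ : 0 ≤ ((s : ℝ) + 1) * ((n : ℝ) + 1) / t ^ 2 := by positivity
  unfold φ₂
  rw [abs_le]
  constructor <;> linarith

/-! ### Continuity on `(rn, ∞)` -/

/-- `R` is continuous on `(rn, ∞)`. [folklore] -/
theorem continuousOn_R (hD : 0 < D) : ContinuousOn (Rfun r D s n) (Set.Ioi ((r : ℝ) * n)) :=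
  fun _t ht => (continuousAt_R (s := s) hD ht).continuousWithinAt

/-- `φ₁` is continuous on `(rn, ∞)`. [folklore] -/
theorem continuousOn_φ₁ : ContinuousOn (φ₁ r D s n) (Set.Ioi ((r : ℝ) * n)) :=
  fun _t ht => (continuousAt_φ₁ (D := D) (s := s) ht).continuousWithinAt

/-- `φ₂` is continuous on `(rn, ∞)`. [folklore] -/
theorem continuousOn_φ₂ : ContinuousOn (φ₂ r D s n) (Set.Ioi ((r : ℝ) * n)) := by
  have h1 : ∀ l ∈ range (Lnum r D n + 1), ContinuousOn
      (fun t : ℝ => 1 / (t - r * n + (l : ℝ) / D) ^ 2) (Set.Ioi ((r : ℝ) * n)) := by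
    intro l _
    exact continuousOn_const.div (((continuousOn_id.sub continuousOn_const).add
      continuousOn_const).pow 2) fun t ht => pow_ne_zero _ (factor_pos l ht).ne'
  have h2 : ∀ k ∈ range (n + 1), ContinuousOn (fun t : ℝ => 1 / (t + (k : ℝ)) ^ 2)
      (Set.Ioi ((r : ℝ) * n)) := by
    intro k _
    exact continuousOn_const.div ((continuousOn_id.add continuousOn_const).pow 2)
      fun t ht => pow_ne_zero _ (add_nat_pos (pos_of_gt ht) k).ne'
  unfold φ₂
  exact (continuousOn_finsetSum _ h1).neg.add
    (continuousOn_const.mul (continuousOn_finsetSum _ h2))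

/-! ### Exponential growth of `R` where `φ₁ ≥ 1` -/

/-- If `φ₁ ≥ 1` on `[t₁, t₂] ⊂ (rn, ∞)` then `R(t₁) e^{t₂ - t₁} ≤ R(t₂)`. [folklore] -/
theorem R_growth (hD : 0 < D) {t₁ t₂ : ℝ} (h1 : (r : ℝ) * n < t₁) (h12 : t₁ ≤ t₂)
    (hφ : ∀ t ∈ Set.Icc t₁ t₂, 1 ≤ φ₁ r D s n t) :
    Rfun r D s n t₁ * Real.exp (t₂ - t₁) ≤ Rfun r D s n t₂ := by
  have hmono : MonotoneOn (fun t => ψ r D s n t - t) (Set.Icc t₁ t₂) := by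
    apply monotoneOn_of_hasDerivWithinAt_nonneg (convex_Icc t₁ t₂)
      (f' := fun t => φ₁ r D s n t - 1)
    · intro t ht
      have ht' : (r : ℝ) * n < t := lt_of_lt_of_le h1 ht.1
      exact ((hasDerivAt_ψ ht').sub (hasDerivAt_id' t)).continuousAt.continuousWithinAt
    · intro t ht
      rw [interior_Icc] at ht
      have ht' : (r : ℝ) * n < t := lt_of_lt_of_le h1 ht.1.le
      exact ((hasDerivAt_ψ ht').sub (hasDerivAt_id' t)).hasDerivWithinAt
    · intro t ht
      rw [interior_Icc] at ht
      have := hφ t (Set.Ioo_subset_Icc_self ht)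
      show (0 : ℝ) ≤ φ₁ r D s n t - 1
      linarith
  have := hmono (Set.left_mem_Icc.mpr h12) (Set.right_mem_Icc.mpr h12) h12
  simp only at this
  rw [R_eq_exp hD h1, R_eq_exp hD (lt_of_lt_of_le h1 h12), ← Real.exp_add]
  exact Real.exp_le_exp.mpr (by linarith)

/-! ### A Riemann-sum cell estimate -/

/-- For `g` differentiable on `[x, y]` with continuous derivative:
`|g(y)(y-x) - ∫_x^y g| ≤ (y-x) ∫_x^y |g'|`. [folklore] -/
theorem cell_bound {g g' : ℝ → ℝ} {x y : ℝ} (hxy : x ≤ y)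
    (hg : ∀ t ∈ Set.Icc x y, HasDerivAt g (g' t) t) (hg' : ContinuousOn g' (Set.Icc x y)) :
    |g y * (y - x) - ∫ t in x..y, g t| ≤ (y - x) * ∫ t in x..y, |g' t| := by
  have hgc : ContinuousOn g (Set.Icc x y) := fun t ht => (hg t ht).continuousAt.continuousWithinAt
  have hg'abs : ContinuousOn (fun t => |g' t|) (Set.Icc x y) := continuous_abs.comp_continuousOn hg'
  set C := ∫ t in x..y, |g' t| with hC
  have hbound : ∀ v ∈ Set.Icc x y, |g y - g v| ≤ C := by
    intro v hv
    have hsub : Set.uIcc v y ⊆ Set.Icc x y := by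
      rw [Set.uIcc_of_le hv.2]; exact Set.Icc_subset_Icc hv.1 le_rfl
    have hftc : ∫ t in v..y, g' t = g y - g v :=
      intervalIntegral.integral_eq_sub_of_hasDerivAt (fun t ht => hg t (hsub ht))
        ((hg'.mono hsub).intervalIntegrable)
    rw [← hftc]
    have hsub' : Set.uIcc x y ⊆ Set.Icc x y := by rw [Set.uIcc_of_le hxy]
    calc |∫ t in v..y, g' t| ≤ ∫ t in v..y, |g' t| :=
          intervalIntegral.abs_integral_le_integral_abs hv.2
      _ ≤ C := intervalIntegral.integral_mono_interval hv.1 hv.2 le_rfl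
          (Filter.Eventually.of_forall fun t => abs_nonneg _)
          ((hg'abs.mono hsub').intervalIntegrable)
  have hgi : IntervalIntegrable g MeasureTheory.volume x y :=
    (hgc.mono (by rw [Set.uIcc_of_le hxy])).intervalIntegrable
  have h1 : g y * (y - x) - ∫ t in x..y, g t = ∫ t in x..y, (g y - g t) := by
    rw [intervalIntegral.integral_sub intervalIntegrable_const hgi, intervalIntegral.integral_const,
      smul_eq_mul]
    ring
  rw [h1]
  have key := intervalIntegral.norm_integral_le_of_norm_le_const (a := x) (b := y) (C := C)
    (f := fun t => g y - g t) (fun t ht => by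
      rw [Set.uIoc_of_le hxy] at ht
      rw [Real.norm_eq_abs]
      exact hbound t ⟨ht.1.le, ht.2⟩)
  rw [Real.norm_eq_abs, abs_of_nonneg (sub_nonneg.mpr hxy)] at key
  linarith

/-! ### Integration by parts: `∫ R φ₁² ≤ C₁ R(X) + c₂ ∫ R` -/

/-- On `[T, X] ⊂ (rn, ∞)` with `φ₁(T) ≥ 0`, `|φ₁| ≤ C₁`, `|φ₂| ≤ c₂`:
`∫_T^X R φ₁² ≤ C₁ R(X) + c₂ ∫_T^X R` (integrate `R φ₁² = R' φ₁` by parts). [folklore] -/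
theorem integral_R_mul_sq_le (hD : 0 < D) {T X C₁ c₂ : ℝ} (hT : (r : ℝ) * n < T) (hTX : T ≤ X)
    (hφT : 0 ≤ φ₁ r D s n T) (hC₁ : ∀ t ∈ Set.Icc T X, |φ₁ r D s n t| ≤ C₁)
    (hc₂ : ∀ t ∈ Set.Icc T X, |φ₂ r D s n t| ≤ c₂) :
    ∫ t in T..X, Rfun r D s n t * φ₁ r D s n t ^ 2 ≤
      C₁ * Rfun r D s n X + c₂ * ∫ t in T..X, Rfun r D s n t := by
  have hsub : Set.Icc T X ⊆ Set.Ioi ((r : ℝ) * n) := fun t ht => lt_of_lt_of_le hT ht.1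
  have huIcc : Set.uIcc T X = Set.Icc T X := Set.uIcc_of_le hTX
  have hRc : ContinuousOn (Rfun r D s n) (Set.uIcc T X) := huIcc ▸ (continuousOn_R hD).mono hsub
  have hφ₁c : ContinuousOn (φ₁ r D s n) (Set.uIcc T X) := huIcc ▸ (continuousOn_φ₁ (D := D) (s := s)).mono hsub
  have hφ₂c : ContinuousOn (φ₂ r D s n) (Set.uIcc T X) := huIcc ▸ (continuousOn_φ₂ (D := D) (s := s)).mono hsub
  have hRφc : ContinuousOn (fun t => Rfun r D s n t * φ₁ r D s n t) (Set.uIcc T X) := hRc.mul hφ₁c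
  have hibp := intervalIntegral.integral_mul_deriv_eq_deriv_mul (a := T) (b := X)
    (u := φ₁ r D s n) (u' := φ₂ r D s n) (v := Rfun r D s n)
    (v' := fun t => Rfun r D s n t * φ₁ r D s n t)
    (fun t ht => hasDerivAt_φ₁ (hsub (huIcc ▸ ht)))
    (fun t ht => hasDerivAt_R hD (hsub (huIcc ▸ ht)))
    hφ₂c.intervalIntegrable hRφc.intervalIntegrable
  have hlhs : ∫ t in T..X, Rfun r D s n t * φ₁ r D s n t ^ 2 =
      ∫ t in T..X, φ₁ r D s n t * (Rfun r D s n t * φ₁ r D s n t) :=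
    intervalIntegral.integral_congr fun t _ => by ring
  rw [hlhs, hibp]
  have hRX : 0 < Rfun r D s n X := R_pos hD (lt_of_lt_of_le hT hTX)
  have hRT : 0 < Rfun r D s n T := R_pos hD hT
  have h1 : φ₁ r D s n X * Rfun r D s n X ≤ C₁ * Rfun r D s n X := by
    have := hC₁ X (Set.right_mem_Icc.mpr hTX)
    have := (abs_le.mp this).2
    nlinarith
  have h2 : 0 ≤ φ₁ r D s n T * Rfun r D s n T := mul_nonneg hφT hRT.le
  have h3 : -(∫ t in T..X, φ₂ r D s n t * Rfun r D s n t) ≤ c₂ * ∫ t in T..X, Rfun r D s n t := by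
    rw [← intervalIntegral.integral_neg, ← intervalIntegral.integral_const_mul]
    refine intervalIntegral.integral_mono_on hTX ?_ ?_ fun t ht => ?_
    · exact (hφ₂c.mul hRc).intervalIntegrable.neg
    · exact (hRc.intervalIntegrable).const_mul c₂
    · have hb := abs_le.mp (hc₂ t ht)
      have hRt : 0 < Rfun r D s n t := R_pos hD (hsub ht)
      nlinarith
  linarith

/-! ### Total variation by AM–GM: `∫ |R'| ≤ (λ ∫ R + λ⁻¹ ∫ R φ₁²)/2` -/

/-- For any `λ > 0`: `∫_T^X |R φ₁| ≤ (λ ∫_T^X R + λ⁻¹ ∫_T^X R φ₁²) / 2`. [folklore] -/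
theorem integral_abs_deriv_le (hD : 0 < D) {T X lam : ℝ} (hT : (r : ℝ) * n < T) (hTX : T ≤ X)
    (hlam : 0 < lam) :
    ∫ t in T..X, |Rfun r D s n t * φ₁ r D s n t| ≤
      (lam * (∫ t in T..X, Rfun r D s n t) +
        (1 / lam) * ∫ t in T..X, Rfun r D s n t * φ₁ r D s n t ^ 2) / 2 := by
  have hsub : Set.Icc T X ⊆ Set.Ioi ((r : ℝ) * n) := fun t ht => lt_of_lt_of_le hT ht.1
  have huIcc : Set.uIcc T X = Set.Icc T X := Set.uIcc_of_le hTX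
  have hRc : ContinuousOn (Rfun r D s n) (Set.uIcc T X) := huIcc ▸ (continuousOn_R hD).mono hsub
  have hφ₁c : ContinuousOn (φ₁ r D s n) (Set.uIcc T X) := huIcc ▸ (continuousOn_φ₁ (D := D) (s := s)).mono hsub
  have hi1 : IntervalIntegrable (fun t => |Rfun r D s n t * φ₁ r D s n t|) MeasureTheory.volume T X :=
    (continuous_abs.comp_continuousOn (hRc.mul hφ₁c)).intervalIntegrable
  have hRφ2c : ContinuousOn (fun t => Rfun r D s n t * φ₁ r D s n t ^ 2) (Set.uIcc T X) :=
    hRc.mul (hφ₁c.pow 2)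
  have hI1 : IntervalIntegrable (fun t => lam / 2 * Rfun r D s n t) MeasureTheory.volume T X :=
    (hRc.intervalIntegrable).const_mul _
  have hI2 : IntervalIntegrable (fun t => 1 / (2 * lam) * (Rfun r D s n t * φ₁ r D s n t ^ 2))
      MeasureTheory.volume T X := hRφ2c.intervalIntegrable.const_mul _
  have hi2 : IntervalIntegrable (fun t => lam / 2 * Rfun r D s n t +
      1 / (2 * lam) * (Rfun r D s n t * φ₁ r D s n t ^ 2)) MeasureTheory.volume T X := hI1.add hI2
  have hpt : ∀ t ∈ Set.Icc T X, |Rfun r D s n t * φ₁ r D s n t| ≤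
      lam / 2 * Rfun r D s n t + 1 / (2 * lam) * (Rfun r D s n t * φ₁ r D s n t ^ 2) := by
    intro t ht
    have hRt : 0 < Rfun r D s n t := R_pos hD (hsub ht)
    rw [abs_mul, abs_of_pos hRt]
    have key : 0 ≤ Rfun r D s n t / (2 * lam) * (lam - |φ₁ r D s n t|) ^ 2 := by positivity
    have e : Rfun r D s n t / (2 * lam) * (lam - |φ₁ r D s n t|) ^ 2 =
        lam / 2 * Rfun r D s n t + 1 / (2 * lam) * (Rfun r D s n t * φ₁ r D s n t ^ 2) -
          Rfun r D s n t * |φ₁ r D s n t| := by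
      have : |φ₁ r D s n t| ^ 2 = φ₁ r D s n t ^ 2 := sq_abs _
      field_simp
      nlinarith [this]
    linarith
  calc ∫ t in T..X, |Rfun r D s n t * φ₁ r D s n t|
      ≤ ∫ t in T..X, (lam / 2 * Rfun r D s n t + 1 / (2 * lam) * (Rfun r D s n t * φ₁ r D s n t ^ 2)) :=
        intervalIntegral.integral_mono_on hTX hi1 hi2 hpt
    _ = (lam * (∫ t in T..X, Rfun r D s n t) +
          (1 / lam) * ∫ t in T..X, Rfun r D s n t * φ₁ r D s n t ^ 2) / 2 := by
        rw [intervalIntegral.integral_add hI1 hI2,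
          intervalIntegral.integral_const_mul, intervalIntegral.integral_const_mul]
        ring

/-! ### Riemann sums of `R` over `(1/d)ℕ` -/

/-- Partial sums `PS(d, X) = (1/d) ∑_{1 ≤ m ≤ dX} R(m/d)` of the samples of `R` on `(1/d)ℕ`.
[folklore] -/
def PS (r D s n d X : ℕ) : ℝ := ∑ m ∈ range (d * X), Rfun r D s n (((m : ℝ) + 1) / d) / d

/-- `(dk)/d = k` in `ℝ`. [folklore] -/
theorem cast_mul_div_cancel {d k : ℕ} (hd : 0 < d) : ((d * k : ℕ) : ℝ) / d = k := by
  have : (d : ℝ) ≠ 0 := by exact_mod_cast hd.ne'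
  push_cast
  field_simp

/-- **Low + high decomposition.** With `T₀ = rn + u` an integer, `X ≥ T₀ + 2u` an integer,
`d ∣ D`, and `φ₁ ≥ 1` on `(rn, rn + 3u]`:
`|PS(d,X) - ∫_{T₀}^X R| ≤ e^{-u} ∫_{T₀}^X R + ∫_{T₀}^X |R φ₁|`. [folklore] -/
theorem abs_PS_sub_integral_le (hD : 0 < D) {d u T₀ X : ℕ} (hd : d ∣ D) (hu : 0 < u)
    (hT₀ : T₀ = r * n + u) (hX : T₀ + 2 * u ≤ X)
    (HW : ∀ t : ℝ, (r : ℝ) * n < t → t ≤ (r : ℝ) * n + 3 * u → 1 ≤ φ₁ r D s n t) :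
    |PS r D s n d X - ∫ t in (T₀ : ℝ)..X, Rfun r D s n t| ≤
      Real.exp (-(u : ℝ)) * (∫ t in (T₀ : ℝ)..X, Rfun r D s n t) +
        ∫ t in (T₀ : ℝ)..X, |Rfun r D s n t * φ₁ r D s n t| := by
  have hd0 : 0 < d := Nat.pos_of_dvd_of_pos hd hD
  have hd' : (0 : ℝ) < d := by exact_mod_cast hd0
  have hdne : (d : ℝ) ≠ 0 := hd'.ne'
  have hu' : (0 : ℝ) < u := by exact_mod_cast hu
  have hT₀' : (T₀ : ℝ) = r * n + u := by rw [hT₀]; push_cast; ring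
  have hrnT₀ : (r : ℝ) * n < T₀ := by rw [hT₀']; linarith
  have hX' : (T₀ : ℝ) + 2 * u ≤ X := by exact_mod_cast hX
  have hT₀X : (T₀ : ℝ) ≤ X := by linarith
  set g : ℕ → ℝ := fun m => Rfun r D s n (((m : ℝ) + 1) / d) / d with hg
  set I := ∫ t in (T₀ : ℝ)..X, Rfun r D s n t with hI
  set V := ∫ t in (T₀ : ℝ)..X, |Rfun r D s n t * φ₁ r D s n t| with hV
  have hRnn : ∀ t, (r : ℝ) * n < t → 0 ≤ Rfun r D s n t := fun t ht => (R_pos hD ht).le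
  -- interval integrability of `R` on subintervals of `(rn, ∞)`
  have hRint : ∀ {x y : ℝ}, (r : ℝ) * n < x → x ≤ y →
      IntervalIntegrable (Rfun r D s n) MeasureTheory.volume x y := by
    intro x y hx hxy
    refine ((continuousOn_R hD).mono fun t ht => ?_).intervalIntegrable
    rw [Set.uIcc_of_le hxy] at ht
    exact lt_of_lt_of_le hx ht.1
  -- monotonicity of the integral of `R ≥ 0` in the interval
  have hIsub : ∀ {x y : ℝ}, (T₀ : ℝ) ≤ x → x ≤ y → y ≤ X → ∫ t in x..y, Rfun r D s n t ≤ I := by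
    intro x y hx hxy hy
    refine intervalIntegral.integral_mono_interval hx hxy hy ?_ (hRint hrnT₀ hT₀X)
    refine MeasureTheory.ae_restrict_of_forall_mem measurableSet_Ioc fun t ht => ?_
    exact hRnn t (lt_trans hrnT₀ ht.1)
  have hInn : 0 ≤ I := by
    rw [hI]
    refine intervalIntegral.integral_nonneg hT₀X fun t ht => hRnn t (lt_of_lt_of_le hrnT₀ ht.1)
  -- growth consequences of `φ₁ ≥ 1` on `(rn, rn+3u]`
  have hgrow : ∀ {t₁ t₂ : ℝ}, (r : ℝ) * n < t₁ → t₁ ≤ t₂ → t₂ ≤ (r : ℝ) * n + 3 * u →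
      Rfun r D s n t₁ * Real.exp (t₂ - t₁) ≤ Rfun r D s n t₂ := by
    intro t₁ t₂ h1 h12 h2
    exact R_growth hD h1 h12 fun t ht => HW t (lt_of_lt_of_le h1 ht.1) (le_trans ht.2 h2)
  have hmono : ∀ {t₁ t₂ : ℝ}, (r : ℝ) * n < t₁ → t₁ ≤ t₂ → t₂ ≤ (r : ℝ) * n + 3 * u →
      Rfun r D s n t₁ ≤ Rfun r D s n t₂ := by
    intro t₁ t₂ h1 h12 h2
    have := hgrow h1 h12 h2
    have he : 1 ≤ Real.exp (t₂ - t₁) := Real.one_le_exp (by linarith)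
    nlinarith [hRnn t₁ h1]
  -- `R(T₀) ≤ e^{-u} I / u`
  have hRT₀ : Rfun r D s n T₀ ≤ Real.exp (-(u : ℝ)) * I / u := by
    have h1 : Rfun r D s n T₀ * Real.exp u ≤ Rfun r D s n (T₀ + u) := by
      have := hgrow hrnT₀ (by linarith : (T₀ : ℝ) ≤ T₀ + u) (by rw [hT₀']; linarith)
      simpa using this
    have h2 : Rfun r D s n (T₀ + u) * u ≤ ∫ t in ((T₀ : ℝ) + u)..((T₀ : ℝ) + 2 * u), Rfun r D s n t := by
      have hc : ∫ t in ((T₀ : ℝ) + u)..((T₀ : ℝ) + 2 * u), Rfun r D s n (T₀ + u) =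
          Rfun r D s n (T₀ + u) * u := by
        rw [intervalIntegral.integral_const, smul_eq_mul]; ring
      rw [← hc]
      refine intervalIntegral.integral_mono_on (by linarith) intervalIntegrable_const
        (hRint (by linarith) (by linarith)) fun t ht => ?_
      exact hmono (by linarith) ht.1 (by rw [hT₀'] at ht; linarith [ht.2])
    have h3 : ∫ t in ((T₀ : ℝ) + u)..((T₀ : ℝ) + 2 * u), Rfun r D s n t ≤ I :=
      hIsub (by linarith) (by linarith) (by linarith)
    have he : 0 < Real.exp (u : ℝ) := Real.exp_pos _
    rw [Real.exp_neg, le_div_iff₀ hu', ← div_eq_inv_mul, le_div_iff₀ he]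
    have h4 := mul_le_mul_of_nonneg_right h1 hu'.le
    nlinarith
  -- the three index ranges
  have hle1 : d * (r * n) ≤ d * T₀ := Nat.mul_le_mul_left d (by omega)
  have hle2 : d * T₀ ≤ d * X := Nat.mul_le_mul_left d (by omega)
  have hsplit : PS r D s n d X =
      ∑ m ∈ Ico 0 (d * (r * n)), g m + ∑ m ∈ Ico (d * (r * n)) (d * T₀), g m +
        ∑ m ∈ Ico (d * T₀) (d * X), g m := by
    unfold PS
    rw [range_eq_Ico, sum_Ico_consecutive _ (Nat.zero_le _) hle1,
      sum_Ico_consecutive _ (Nat.zero_le _) hle2]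
  -- part 0 vanishes
  have hpart0 : ∑ m ∈ Ico 0 (d * (r * n)), g m = 0 := by
    refine sum_eq_zero fun m hm => ?_
    rw [mem_Ico] at hm
    simp only [hg]
    have : Rfun r D s n ((((m + 1 : ℕ)) : ℝ) / d) = 0 :=
      R_sample_eq_zero hd hD (by rw [Nat.mul_assoc]; omega)
    push_cast at this
    rw [this, zero_div]
  -- low part
  have hlow : ∑ m ∈ Ico (d * (r * n)) (d * T₀), g m ≤ Real.exp (-(u : ℝ)) * I := by
    have hterm : ∀ m ∈ Ico (d * (r * n)) (d * T₀), g m ≤ Real.exp (-(u : ℝ)) * I / u / d := by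
      intro m hm
      rw [mem_Ico] at hm
      simp only [hg]
      have hlt : (r : ℝ) * n < ((m : ℝ) + 1) / d := by
        rw [lt_div_iff₀ hd']
        have : ((d * (r * n) : ℕ) : ℝ) ≤ m := by exact_mod_cast hm.1
        push_cast at this
        linarith
      have hle : ((m : ℝ) + 1) / d ≤ T₀ := by
        rw [div_le_iff₀ hd']
        have : (m : ℝ) + 1 ≤ ((d * T₀ : ℕ) : ℝ) := by exact_mod_cast hm.2
        push_cast at this
        linarith
      have := hmono hlt hle (by rw [hT₀']; linarith)
      exact div_le_div_of_nonneg_right (this.trans hRT₀) hd'.le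
    calc ∑ m ∈ Ico (d * (r * n)) (d * T₀), g m
        ≤ ∑ _m ∈ Ico (d * (r * n)) (d * T₀), Real.exp (-(u : ℝ)) * I / u / d := sum_le_sum hterm
      _ = ((d * T₀ - d * (r * n) : ℕ) : ℝ) * (Real.exp (-(u : ℝ)) * I / u / d) := by
          rw [sum_const, Nat.card_Ico, nsmul_eq_mul]
      _ = Real.exp (-(u : ℝ)) * I := by
          have : ((d * T₀ - d * (r * n) : ℕ) : ℝ) = d * u := by
            rw [← Nat.mul_sub, hT₀, Nat.add_sub_cancel_left]; push_cast; ring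
          rw [this]
          field_simp
  have hlow0 : 0 ≤ ∑ m ∈ Ico (d * (r * n)) (d * T₀), g m := by
    refine sum_nonneg fun m hm => ?_
    rw [mem_Ico] at hm
    simp only [hg]
    refine div_nonneg (hRnn _ ?_) hd'.le
    rw [lt_div_iff₀ hd']
    have : ((d * (r * n) : ℕ) : ℝ) ≤ m := by exact_mod_cast hm.1
    push_cast at this
    linarith
  -- high part: cells
  set A : ℕ → ℝ := fun k => (k : ℝ) / d with hA
  have hAT₀ : A (d * T₀) = T₀ := by simp only [hA]; exact cast_mul_div_cancel hd0
  have hAX : A (d * X) = X := by simp only [hA]; exact cast_mul_div_cancel hd0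
  have hAsucc : ∀ k, A (k + 1) = A k + 1 / d := by
    intro k; simp only [hA]; push_cast; ring
  have hAgt : ∀ k, d * T₀ ≤ k → (r : ℝ) * n < A k := by
    intro k hk
    simp only [hA]
    rw [lt_div_iff₀ hd']
    have : ((d * T₀ : ℕ) : ℝ) ≤ k := by exact_mod_cast hk
    push_cast at this
    nlinarith
  have hcell : ∀ k ∈ Ico (d * T₀) (d * X),
      |g k - ∫ t in A k..A (k + 1), Rfun r D s n t| ≤
        (1 / d) * ∫ t in A k..A (k + 1), |Rfun r D s n t * φ₁ r D s n t| := by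
    intro k hk
    rw [mem_Ico] at hk
    have hk1 := hAgt k hk.1
    have hxy : A k ≤ A (k + 1) := by rw [hAsucc]; linarith [one_div_pos.mpr hd']
    have hsubI : Set.Icc (A k) (A (k + 1)) ⊆ Set.Ioi ((r : ℝ) * n) := fun t ht =>
      lt_of_lt_of_le hk1 ht.1
    have hcb := cell_bound (g := Rfun r D s n) (g' := fun t => Rfun r D s n t * φ₁ r D s n t) hxy
      (fun t ht => hasDerivAt_R hD (hsubI ht))
      (((continuousOn_R hD).mul (continuousOn_φ₁ (D := D) (s := s))).mono hsubI)
    have hgk : g k = Rfun r D s n (A (k + 1)) * (A (k + 1) - A k) := by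
      simp only [hg, hA]; push_cast; field_simp; ring
    rw [hgk]
    calc |Rfun r D s n (A (k + 1)) * (A (k + 1) - A k) - ∫ t in A k..A (k + 1), Rfun r D s n t|
        ≤ (A (k + 1) - A k) * ∫ t in A k..A (k + 1), |Rfun r D s n t * φ₁ r D s n t| := hcb
      _ = (1 / d) * ∫ t in A k..A (k + 1), |Rfun r D s n t * φ₁ r D s n t| := by
          rw [hAsucc]; ring
  have hIcells : ∑ k ∈ Ico (d * T₀) (d * X), ∫ t in A k..A (k + 1), Rfun r D s n t = I := by
    rw [hI, ← hAT₀, ← hAX]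
    refine intervalIntegral.sum_integral_adjacent_intervals_Ico hle2 fun k hk => ?_
    exact hRint (hAgt k hk.1) (by rw [hAsucc]; linarith [one_div_pos.mpr hd'])
  have hVcells : ∑ k ∈ Ico (d * T₀) (d * X),
      ∫ t in A k..A (k + 1), |Rfun r D s n t * φ₁ r D s n t| = V := by
    rw [hV, ← hAT₀, ← hAX]
    refine intervalIntegral.sum_integral_adjacent_intervals_Ico hle2 fun k hk => ?_
    have hk1 := hAgt k hk.1
    refine ((continuous_abs.comp_continuousOn
      ((continuousOn_R hD).mul (continuousOn_φ₁ (D := D) (s := s)))).mono fun t ht => ?_).intervalIntegrable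
    rw [Set.uIcc_of_le (by rw [hAsucc]; linarith [one_div_pos.mpr hd'])] at ht
    exact lt_of_lt_of_le hk1 ht.1
  have hVnn : 0 ≤ V := by
    rw [hV]
    exact intervalIntegral.integral_nonneg hT₀X fun t _ => abs_nonneg _
  have hhigh : |∑ m ∈ Ico (d * T₀) (d * X), g m - I| ≤ V := by
    rw [← hIcells, ← sum_sub_distrib]
    calc |∑ k ∈ Ico (d * T₀) (d * X), (g k - ∫ t in A k..A (k + 1), Rfun r D s n t)|
        ≤ ∑ k ∈ Ico (d * T₀) (d * X), |g k - ∫ t in A k..A (k + 1), Rfun r D s n t| :=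
          abs_sum_le_sum_abs _ _
      _ ≤ ∑ k ∈ Ico (d * T₀) (d * X),
            (1 / d) * ∫ t in A k..A (k + 1), |Rfun r D s n t * φ₁ r D s n t| := sum_le_sum hcell
      _ = (1 / d) * V := by rw [← mul_sum, hVcells]
      _ ≤ 1 * V := by
          refine mul_le_mul_of_nonneg_right ?_ hVnn
          rw [div_le_one hd']
          exact_mod_cast hd0
      _ = V := one_mul V
  -- conclusion
  rw [hsplit, hpart0, zero_add]
  have := abs_le.mp hhigh
  rw [abs_le]
  constructor <;> nlinarith [mul_nonneg (Real.exp_pos (-(u : ℝ))).le hInn]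

/-- **Total variation estimate.** On `[T, X] ⊂ (rn, ∞)` with `φ₁(T) ≥ 0`, `|φ₁| ≤ C₁`,
`|φ₂| ≤ c₂`, `c₂ > 0`: `∫_T^X |R φ₁| ≤ √c₂ ∫_T^X R + C₁ R(X) / (2 √c₂)`
(AM–GM with `λ = √c₂` plus the integration by parts bound). [folklore] -/
theorem tv_le (hD : 0 < D) {T X C₁ c₂ : ℝ} (hT : (r : ℝ) * n < T) (hTX : T ≤ X)
    (hφT : 0 ≤ φ₁ r D s n T) (hC₁ : ∀ t ∈ Set.Icc T X, |φ₁ r D s n t| ≤ C₁)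
    (hc₂ : ∀ t ∈ Set.Icc T X, |φ₂ r D s n t| ≤ c₂) (hc₂pos : 0 < c₂) :
    ∫ t in T..X, |Rfun r D s n t * φ₁ r D s n t| ≤
      Real.sqrt c₂ * (∫ t in T..X, Rfun r D s n t) + C₁ * Rfun r D s n X / (2 * Real.sqrt c₂) := by
  set lam := Real.sqrt c₂ with hlam
  have hlam0 : 0 < lam := Real.sqrt_pos.mpr hc₂pos
  have hlam2 : lam ^ 2 = c₂ := Real.sq_sqrt hc₂pos.le
  have hV := integral_abs_deriv_le (s := s) hD hT hTX hlam0
  have hJ := integral_R_mul_sq_le hD hT hTX hφT hC₁ hc₂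
  set I := ∫ t in T..X, Rfun r D s n t
  set J := ∫ t in T..X, Rfun r D s n t * φ₁ r D s n t ^ 2
  have h1 : (1 / lam) * J ≤ (1 / lam) * (C₁ * Rfun r D s n X + c₂ * I) :=
    mul_le_mul_of_nonneg_left hJ (by positivity)
  have h2 : (lam * I + (1 / lam) * (C₁ * Rfun r D s n X + c₂ * I)) / 2 =
      lam * I + C₁ * Rfun r D s n X / (2 * lam) := by
    field_simp
    rw [← hlam2]
    ring
  linarith

/-! ### The window `(rn, rn + 3u]`: `φ₁ ≥ 1` there, for `u = ⌊n/K⌋ + 1` -/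

/-- `n/K < ⌊n/K⌋ + 1` in `ℝ`. [folklore] -/
theorem div_lt_floor_add_one {K : ℕ} (hK : 0 < K) : (n : ℝ) / K < (n / K : ℕ) + 1 := by
  have hK' : (0 : ℝ) < K := by exact_mod_cast hK
  rw [div_lt_iff₀ hK']
  have h := Nat.div_add_mod n K
  have hmod := Nat.mod_lt n hK
  have : (n : ℝ) = K * (n / K : ℕ) + (n % K : ℕ) := by exact_mod_cast h.symm
  have hmod' : ((n % K : ℕ) : ℝ) < K := by exact_mod_cast hmod
  rw [this]
  nlinarith

/-- `⌊n/K⌋ + 1 ≤ 2n/K` for `n ≥ K ≥ 1`. [folklore] -/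
theorem floor_add_one_le {K : ℕ} (hK : 0 < K) (hn : K ≤ n) : ((n / K : ℕ) : ℝ) + 1 ≤ 2 * n / K := by
  have hK' : (0 : ℝ) < K := by exact_mod_cast hK
  have h1 : ((n / K : ℕ) : ℝ) ≤ (n : ℝ) / K := Nat.cast_div_le
  have h2 : (1 : ℝ) ≤ (n : ℝ) / K := by
    rw [le_div_iff₀ hK']; simpa using (show (K : ℝ) ≤ n by exact_mod_cast hn)
  have : (2 : ℝ) * n / K = (n : ℝ) / K + (n : ℝ) / K := by ring
  linarith

/-- **The window.** If `1 + 2a/r ≤ D log (rK/6)`, `r ≥ 1`, `n ≥ K ≥ 1`, then `φ₁ ≥ 1` on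
`(rn, rn + 3u]` with `u = ⌊n/K⌋ + 1`. [folklore] -/
theorem one_le_φ₁_of_window {K : ℕ} (hD : 0 < D) (hr : 1 ≤ r) (hK : 0 < K) (hn : K ≤ n)
    (hwin : 1 + 2 * ((s : ℝ) + 1) / r ≤ D * Real.log ((r : ℝ) * K / 6)) {t : ℝ}
    (ht : (r : ℝ) * n < t) (ht' : t ≤ (r : ℝ) * n + 3 * (((n / K : ℕ) : ℝ) + 1)) :
    1 ≤ φ₁ r D s n t := by
  have hK' : (0 : ℝ) < K := by exact_mod_cast hK
  have hr' : (1 : ℝ) ≤ r := by exact_mod_cast hr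
  have hn1 : (1 : ℝ) ≤ n := by
    have : (K : ℝ) ≤ n := by exact_mod_cast hn
    have : (1 : ℝ) ≤ K := by exact_mod_cast hK
    linarith
  have hD' : (0 : ℝ) < D := by exact_mod_cast hD
  have ht0 := pos_of_gt ht
  have hu := floor_add_one_le (n := n) hK hn
  have hlow := φ₁_lower (s := s) hD ht
  -- `log t - log (t - rn) ≥ log (rK/6)`
  have hgap : 0 < t - r * n := by linarith
  have hgap' : t - r * n ≤ 6 * n / K := by
    have : (6 : ℝ) * n / K = 3 * (2 * n / K) := by ring
    linarith
  have hrn : (r : ℝ) * n ≤ t := ht.le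
  have hlog : Real.log ((r : ℝ) * K / 6) ≤ Real.log t - Real.log (t - r * n) := by
    rw [← Real.log_div ht0.ne' hgap.ne']
    apply Real.log_le_log (by positivity)
    rw [le_div_iff₀ hgap]
    calc (r : ℝ) * K / 6 * (t - r * n) ≤ (r : ℝ) * K / 6 * (6 * n / K) :=
          mul_le_mul_of_nonneg_left hgap' (by positivity)
      _ = r * n := by field_simp
      _ ≤ t := hrn
  -- `a (n+1)/t ≤ 2a/r`
  have hpole : ((s : ℝ) + 1) * (((n : ℝ) + 1) / t) ≤ 2 * ((s : ℝ) + 1) / r := by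
    have h1 : ((n : ℝ) + 1) / t ≤ 2 / r := by
      rw [div_le_div_iff₀ ht0 (by positivity)]
      nlinarith
    have hs0 : (0 : ℝ) ≤ (s : ℝ) + 1 := by positivity
    calc ((s : ℝ) + 1) * (((n : ℝ) + 1) / t) ≤ ((s : ℝ) + 1) * (2 / r) :=
          mul_le_mul_of_nonneg_left h1 hs0
      _ = 2 * ((s : ℝ) + 1) / r := by ring
  have := mul_le_mul_of_nonneg_left hlog hD'.le
  linarith

/-! ### The sample series `S(d) = (1/d) ∑_{m ≥ 1} R(m/d)` -/

/-- The scale `C_n = 3^{Drn} / r^{(a-2Dr)n}` of the crude bound `R(t) ≤ C_n t^{-a}`. [folklore] -/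
def Cn (r D s n : ℕ) : ℝ :=
  (D : ℝ) ^ Lnum r D n * ((r : ℝ) + 2) ^ (Lnum r D n + 1) / (r : ℝ) ^ (n * (s + 1 - (2 * r + 1) * D))

/-- The samples `R((m+1)/d)`, `m ∈ ℕ`. [folklore] -/
def term (r D s n d : ℕ) (m : ℕ) : ℝ := Rfun r D s n (((m : ℝ) + 1) / d)

/-- `S(d) = (1/d) ∑_{m ≥ 1} R(m/d)`. [folklore] -/
def S (r D s n d : ℕ) : ℝ := (∑' m : ℕ, term r D s n d m) / d

/-- `C_n > 0`. [folklore] -/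
theorem Cn_pos (hD : 0 < D) (hr : 1 ≤ r) : 0 < Cn r D s n := by
  unfold Cn
  have : (0 : ℝ) < r := by exact_mod_cast hr
  have : (0 : ℝ) < D := by exact_mod_cast hD
  positivity

/-- The samples are nonnegative. [folklore] -/
theorem term_nonneg (hD : 0 < D) {d : ℕ} (hd : d ∣ D) (m : ℕ) : 0 ≤ term r D s n d m := by
  unfold term
  have := R_sample_nonneg (r := r) (s := s) (n := n) hd hD (m + 1)
  push_cast at this
  exact this

/-- `R((m+1)/d) ≤ C_n d^s / (m+1)^s`. [folklore] -/
theorem term_le (hD : 0 < D) {d : ℕ} (hd : d ∣ D) (hr : 1 ≤ r) (hs : (2 * r + 1) * D + 2 ≤ s + 1)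
    (m : ℕ) : term r D s n d m ≤ Cn r D s n * (d : ℝ) ^ s / ((m : ℝ) + 1) ^ s := by
  have hd0 : 0 < d := Nat.pos_of_dvd_of_pos hd hD
  have hd' : (0 : ℝ) < d := by exact_mod_cast hd0
  rcases le_or_gt (m + 1) (d * r * n) with h | h
  · have h0 : term r D s n d m = 0 := by
      unfold term
      have := R_sample_eq_zero (r := r) (s := s) (n := n) (m := m + 1) hd hD h
      push_cast at this
      exact this
    rw [h0]
    have := Cn_pos (D := D) (s := s) (n := n) hD hr
    positivity
  · have hlt : (r : ℝ) * n < ((m : ℝ) + 1) / d := by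
      rw [lt_div_iff₀ hd']
      have : ((d * r * n : ℕ) : ℝ) < (m + 1 : ℕ) := by exact_mod_cast h
      push_cast at this
      linarith
    have := R_le (s := s) hD hr (by omega) hlt
    unfold term Cn
    rw [div_pow] at this
    convert this using 1
    field_simp

/-- `(2r+1)D + 2 ≤ s + 1` with `D ≥ 1` forces `s ≥ 2`. [folklore] -/
theorem one_lt_s (hD : 0 < D) (hs : (2 * r + 1) * D + 2 ≤ s + 1) : 1 < s := by
  have h1 : 1 ≤ (2 * r + 1) * D := Nat.one_le_iff_ne_zero.mpr (Nat.mul_ne_zero (by omega) hD.ne')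
  omega

/-- The majorant `C_n d^s / (m+1)^s` is summable (`s ≥ 2`). [folklore] -/
theorem summable_majorant (hD : 0 < D) (hs : (2 * r + 1) * D + 2 ≤ s + 1) (c : ℝ) :
    Summable (fun m : ℕ => c / ((m : ℝ) + 1) ^ s) := by
  have h1 : Summable (fun q : ℕ => 1 / (q : ℝ) ^ s) :=
    Real.summable_one_div_nat_pow.mpr (one_lt_s hD hs)
  have h2 : Summable (fun m : ℕ => 1 / ((m + 1 : ℕ) : ℝ) ^ s) := (summable_nat_add_iff 1).mpr h1
  have h3 : Summable (fun m : ℕ => 1 / ((m : ℝ) + 1) ^ s) := by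
    refine h2.congr fun m => ?_
    push_cast
    rfl
  have := h3.mul_left c
  refine this.congr fun m => ?_
  ring

/-- The sample series converges. [folklore] -/
theorem summable_term (hD : 0 < D) {d : ℕ} (hd : d ∣ D) (hr : 1 ≤ r)
    (hs : (2 * r + 1) * D + 2 ≤ s + 1) : Summable (term r D s n d) :=
  Summable.of_nonneg_of_le (term_nonneg hD hd) (term_le hD hd hr hs)
    (summable_majorant (r := r) hD hs _)

/-- `S(d) ≥ 0`. [folklore] -/
theorem S_nonneg (hD : 0 < D) {d : ℕ} (hd : d ∣ D) : 0 ≤ S r D s n d := by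
  unfold S
  exact div_nonneg (tsum_nonneg (term_nonneg hD hd)) (Nat.cast_nonneg d)

/-- `S(D) > 0`: the sample at `rn + 1/D` is positive. [folklore] -/
theorem S_pos (hD : 0 < D) (hr : 1 ≤ r) (hs : (2 * r + 1) * D + 2 ≤ s + 1) : 0 < S r D s n D := by
  have hD' : (0 : ℝ) < D := by exact_mod_cast hD
  unfold S
  refine div_pos ?_ hD'
  refine (summable_term hD dvd_rfl hr hs).tsum_pos (term_nonneg hD dvd_rfl) (D * r * n) ?_
  unfold term
  refine R_pos hD ?_
  rw [lt_div_iff₀ hD']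
  push_cast
  nlinarith

/-- `PS` as a normalised partial sum of the sample series. [folklore] -/
theorem PS_eq_sum_div (d X : ℕ) :
    PS r D s n d X = (∑ m ∈ range (d * X), term r D s n d m) / d := by
  unfold PS term
  rw [sum_div]

/-- Partial sums are bounded by the full series. [folklore] -/
theorem PS_le_S (hD : 0 < D) {d : ℕ} (hd : d ∣ D) (hr : 1 ≤ r) (hs : (2 * r + 1) * D + 2 ≤ s + 1) (X : ℕ) :
    PS r D s n d X ≤ S r D s n d := by
  rw [PS_eq_sum_div]
  unfold S
  refine div_le_div_of_nonneg_right ?_ (Nat.cast_nonneg d)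
  exact (summable_term hD hd hr hs).sum_le_tsum _ fun m _ => term_nonneg hD hd m

/-- `PS(d, X) → S(d)` as `X → ∞`. [folklore] -/
theorem tendsto_PS (hD : 0 < D) {d : ℕ} (hd : d ∣ D) (hr : 1 ≤ r) (hs : (2 * r + 1) * D + 2 ≤ s + 1) :
    Filter.Tendsto (fun X : ℕ => PS r D s n d X) Filter.atTop (nhds (S r D s n d)) := by
  have hd0 : 0 < d := Nat.pos_of_dvd_of_pos hd hD
  have h1 := (summable_term (n := n) hD hd hr hs).hasSum.tendsto_sum_nat
  have h2 : Filter.Tendsto (fun X : ℕ => d * X) Filter.atTop Filter.atTop :=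
    Filter.tendsto_atTop_mono (fun X => Nat.le_mul_of_pos_left X hd0) Filter.tendsto_id
  have h3 := (h1.comp h2).div_const (d : ℝ)
  unfold S
  refine h3.congr fun X => ?_
  simp only [Function.comp_apply]
  rw [PS_eq_sum_div]

/-- `R(X) → 0` along the integers. [folklore] -/
theorem tendsto_R_nat (hD : 0 < D) (hr : 1 ≤ r) (hs : (2 * r + 1) * D + 2 ≤ s + 1) :
    Filter.Tendsto (fun X : ℕ => Rfun r D s n X) Filter.atTop (nhds 0) := by
  have hs1 : 1 ≤ s := (one_lt_s hD hs).le
  have hC := Cn_pos (D := D) (s := s) (n := n) hD hr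
  have hlim : Filter.Tendsto (fun X : ℕ => Cn r D s n / X) Filter.atTop (nhds 0) :=
    tendsto_const_div_atTop_nhds_zero_nat _
  refine tendsto_of_tendsto_of_tendsto_of_le_of_le' tendsto_const_nhds hlim ?_ ?_
  · filter_upwards [Filter.eventually_gt_atTop (r * n)] with X hX
    have : (r : ℝ) * n < X := by exact_mod_cast hX
    exact (R_pos hD this).le
  · filter_upwards [Filter.eventually_gt_atTop (r * n)] with X hX
    have hX' : (r : ℝ) * n < X := by exact_mod_cast hX
    have hX1 : (1 : ℝ) ≤ X := by
      have : 1 ≤ X := by omega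
      exact_mod_cast this
    have h := R_le (s := s) hD hr (by omega) hX'
    calc Rfun r D s n X ≤ (D : ℝ) ^ Lnum r D n * ((r : ℝ) + 2) ^ (Lnum r D n + 1) /
          ((r : ℝ) ^ (n * (s + 1 - (2 * r + 1) * D)) * (X : ℝ) ^ s) := h
      _ = Cn r D s n / (X : ℝ) ^ s := by unfold Cn; rw [div_div]
      _ ≤ Cn r D s n / X := by
          refine div_le_div_of_nonneg_left hC.le (by positivity) ?_
          calc (X : ℝ) = (X : ℝ) ^ 1 := (pow_one _).symm
            _ ≤ (X : ℝ) ^ s := pow_le_pow_right₀ hX1 hs1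

/-! ### The main comparison for fixed `n` -/

/-- `u = ⌊n/K⌋ + 1`. [folklore] -/
def uu (n K : ℕ) : ℕ := n / K + 1

/-- `T₀ = rn + u`. [folklore] -/
def T₀ (r n K : ℕ) : ℕ := r * n + uu n K

/-- The bound `C₁` for `|φ₁|` on `[T₀, ∞)`. [folklore] -/
def C₁ (r D s n K : ℕ) : ℝ :=
  ((Lnum r D n : ℝ) + 1) / (uu n K) + ((s : ℝ) + 1) * ((n : ℝ) + 1) / (T₀ r n K)

/-- The bound `c₂` for `|φ₂|` on `[T₀, ∞)`. [folklore] -/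
def c₂ (r D s n K : ℕ) : ℝ :=
  ((Lnum r D n : ℝ) + 1) / ((uu n K : ℕ) : ℝ) ^ 2 +
    ((s : ℝ) + 1) * ((n : ℝ) + 1) / ((T₀ r n K : ℕ) : ℝ) ^ 2

/-- `ε_n = e^{-u} + √c₂`. [folklore] -/
def ε (r D s n K : ℕ) : ℝ := Real.exp (-(uu n K : ℝ)) + Real.sqrt (c₂ r D s n K)

/-- `u > 0`. [folklore] -/
theorem uu_pos (n K : ℕ) : 0 < uu n K := Nat.succ_pos _

/-- `c₂ > 0`. [folklore] -/
theorem c₂_pos (r D s n K : ℕ) : 0 < c₂ r D s n K := by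
  unfold c₂
  have h2 : (0 : ℝ) < ((uu n K : ℕ) : ℝ) := by exact_mod_cast uu_pos n K
  have h3 : 0 ≤ ((s : ℝ) + 1) * ((n : ℝ) + 1) / ((T₀ r n K : ℕ) : ℝ) ^ 2 := by positivity
  have : 0 < ((Lnum r D n : ℝ) + 1) / ((uu n K : ℕ) : ℝ) ^ 2 := by positivity
  linarith

/-- `ε_n ≥ 0`. [folklore] -/
theorem ε_nonneg (r D s n K : ℕ) : 0 ≤ ε r D s n K := by
  unfold ε; positivity

/-- **Finite-`X` comparison.** For `X ≥ T₀ + 2u`: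
`|PS(d,X) - ∫_{T₀}^X R| ≤ ε ∫_{T₀}^X R + C₁ R(X)/(2√c₂)`. [folklore] -/
theorem abs_PS_sub_integral_le' {K : ℕ} (hD : 0 < D) (hr : 1 ≤ r)
    (hK : 0 < K) (hn : K ≤ n) (hwin : 1 + 2 * ((s : ℝ) + 1) / r ≤ D * Real.log ((r : ℝ) * K / 6))
    {d X : ℕ} (hd : d ∣ D) (hX : T₀ r n K + 2 * uu n K ≤ X) :
    |PS r D s n d X - ∫ t in (T₀ r n K : ℝ)..X, Rfun r D s n t| ≤
      ε r D s n K * (∫ t in (T₀ r n K : ℝ)..X, Rfun r D s n t) +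
        C₁ r D s n K * Rfun r D s n X / (2 * Real.sqrt (c₂ r D s n K)) := by
  have hn1 : 1 ≤ n := le_trans hK hn
  have HW : ∀ t : ℝ, (r : ℝ) * n < t → t ≤ (r : ℝ) * n + 3 * (uu n K : ℕ) → 1 ≤ φ₁ r D s n t := by
    intro t ht ht'
    refine one_le_φ₁_of_window hD hr hK hn hwin ht ?_
    unfold uu at ht'; push_cast at ht'; exact ht'
  have hA := abs_PS_sub_integral_le (s := s) hD hd (uu_pos n K) (rfl : T₀ r n K = r * n + uu n K)
    hX HW
  -- bounds on `[T₀, X]`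
  have hu' : (0 : ℝ) < (uu n K : ℕ) := by exact_mod_cast uu_pos n K
  have hT₀' : ((T₀ r n K : ℕ) : ℝ) = r * n + (uu n K : ℕ) := by unfold T₀; push_cast; ring
  have hrnT₀ : (r : ℝ) * n < (T₀ r n K : ℕ) := by rw [hT₀']; linarith
  have hT₀pos : (0 : ℝ) < (T₀ r n K : ℕ) := pos_of_gt hrnT₀
  have hT₀X : ((T₀ r n K : ℕ) : ℝ) ≤ X := by exact_mod_cast (le_trans (Nat.le_add_right _ _) hX)
  have hφT : 0 ≤ φ₁ r D s n (T₀ r n K : ℕ) :=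
    le_trans zero_le_one (HW _ hrnT₀ (by rw [hT₀']; linarith))
  have hnum : 0 ≤ ((s : ℝ) + 1) * ((n : ℝ) + 1) := by positivity
  have hC₁ : ∀ t ∈ Set.Icc ((T₀ r n K : ℕ) : ℝ) X, |φ₁ r D s n t| ≤ C₁ r D s n K := by
    intro t ht
    have ht0 : 0 < t := lt_of_lt_of_le hT₀pos ht.1
    have ht1 : (r : ℝ) * n + (uu n K : ℕ) ≤ t := by rw [← hT₀']; exact ht.1
    have h := abs_φ₁_le (D := D) (s := s) hu' ht1
    unfold C₁
    have : ((s : ℝ) + 1) * ((n : ℝ) + 1) / t ≤ ((s : ℝ) + 1) * ((n : ℝ) + 1) / (T₀ r n K : ℕ) :=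
      div_le_div_of_nonneg_left hnum hT₀pos ht.1
    linarith
  have hc₂ : ∀ t ∈ Set.Icc ((T₀ r n K : ℕ) : ℝ) X, |φ₂ r D s n t| ≤ c₂ r D s n K := by
    intro t ht
    have ht0 : 0 < t := lt_of_lt_of_le hT₀pos ht.1
    have ht1 : (r : ℝ) * n + (uu n K : ℕ) ≤ t := by rw [← hT₀']; exact ht.1
    have h := abs_φ₂_le (D := D) (s := s) hu' ht1
    unfold c₂
    have : ((s : ℝ) + 1) * ((n : ℝ) + 1) / t ^ 2 ≤
        ((s : ℝ) + 1) * ((n : ℝ) + 1) / ((T₀ r n K : ℕ) : ℝ) ^ 2 :=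
      div_le_div_of_nonneg_left hnum (by positivity) (pow_le_pow_left₀ hT₀pos.le ht.1 2)
    linarith
  have hB := tv_le hD hrnT₀ hT₀X hφT hC₁ hc₂ (c₂_pos r D s n K)
  unfold ε
  have hInn : 0 ≤ ∫ t in ((T₀ r n K : ℕ) : ℝ)..X, Rfun r D s n t :=
    intervalIntegral.integral_nonneg hT₀X fun t ht => (R_pos hD (lt_of_lt_of_le hrnT₀ ht.1)).le
  nlinarith [hA, hB, Real.sqrt_nonneg (c₂ r D s n K), (Real.exp_pos (-(uu n K : ℝ))).le]

/-- **Comparison of the sample series for fixed `n`.** If moreover `ε_n ≤ 1/2`, then for all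
divisors `d, d'` of `D`: `|S(d) - S(d')| ≤ 4 ε_n S(D)`. [folklore] -/
theorem abs_S_sub_S_le {K : ℕ} (hD : 0 < D) (hr : 1 ≤ r) (hs : (2 * r + 1) * D + 2 ≤ s + 1)
    (hK : 0 < K) (hn : K ≤ n) (hwin : 1 + 2 * ((s : ℝ) + 1) / r ≤ D * Real.log ((r : ℝ) * K / 6))
    (hε : ε r D s n K ≤ 1 / 2) {d d' : ℕ} (hd : d ∣ D) (hd' : d' ∣ D) :
    |S r D s n d - S r D s n d'| ≤ 4 * ε r D s n K * S r D s n D := by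
  set e := ε r D s n K with he
  set SD := S r D s n D with hSD
  set B : ℕ → ℝ := fun X => C₁ r D s n K * Rfun r D s n X / (2 * Real.sqrt (c₂ r D s n K)) with hB
  have he0 : 0 ≤ e := ε_nonneg r D s n K
  have hSD0 : 0 ≤ SD := S_nonneg hD dvd_rfl
  -- the finite-`X` inequality
  have hfin : ∀ X : ℕ, T₀ r n K + 2 * uu n K ≤ X →
      |PS r D s n d X - PS r D s n d' X| ≤ 4 * e * SD + 4 * B X := by
    intro X hX
    have h1 := abs_PS_sub_integral_le' hD hr hK hn hwin hd hX
    have h2 := abs_PS_sub_integral_le' hD hr hK hn hwin hd' hX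
    have h3 := abs_PS_sub_integral_le' hD hr hK hn hwin (dvd_refl D) hX
    have h4 : PS r D s n D X ≤ SD := PS_le_S hD dvd_rfl hr hs X
    set I := ∫ t in (T₀ r n K : ℝ)..X, Rfun r D s n t
    have hn1 : 1 ≤ n := le_trans hK hn
    have hT₀' : ((T₀ r n K : ℕ) : ℝ) = r * n + (uu n K : ℕ) := by unfold T₀; push_cast; ring
    have hu' : (0 : ℝ) < (uu n K : ℕ) := by exact_mod_cast uu_pos n K
    have hrnT₀ : (r : ℝ) * n < (T₀ r n K : ℕ) := by rw [hT₀']; linarith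
    have hT₀X : ((T₀ r n K : ℕ) : ℝ) ≤ X := by
      exact_mod_cast (le_trans (Nat.le_add_right _ _) hX)
    have hInn : 0 ≤ I :=
      intervalIntegral.integral_nonneg hT₀X fun t ht => (R_pos hD (lt_of_lt_of_le hrnT₀ ht.1)).le
    have hBX : 0 ≤ B X := by
      simp only [hB]
      have : 0 ≤ C₁ r D s n K := by unfold C₁; positivity
      have hRX : 0 ≤ Rfun r D s n X := (R_pos hD (lt_of_lt_of_le hrnT₀ hT₀X)).le
      positivity
    have e1 := abs_le.mp h1
    have e2 := abs_le.mp h2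
    have e3 := abs_le.mp h3
    -- `(1 - e) I ≤ SD + B X`, hence `I ≤ 2 SD + 2 B X`
    have hI : I ≤ 2 * SD + 2 * B X := by nlinarith
    rw [abs_le]
    constructor <;> nlinarith [mul_nonneg he0 hInn]
  -- pass to the limit `X → ∞`
  have hlimL : Filter.Tendsto (fun X : ℕ => |PS r D s n d X - PS r D s n d' X|) Filter.atTop
      (nhds |S r D s n d - S r D s n d'|) :=
    ((tendsto_PS hD hd hr hs).sub (tendsto_PS hD hd' hr hs)).abs
  have hlimB : Filter.Tendsto B Filter.atTop (nhds 0) := by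
    have := ((tendsto_R_nat (n := n) hD hr hs).const_mul (C₁ r D s n K)).div_const
      (2 * Real.sqrt (c₂ r D s n K))
    simpa [hB] using this
  have hlimR : Filter.Tendsto (fun X : ℕ => 4 * e * SD + 4 * B X) Filter.atTop
      (nhds (4 * e * SD)) := by
    have := (hlimB.const_mul 4).const_add (4 * e * SD)
    simpa using this
  exact le_of_tendsto_of_tendsto hlimL hlimR (Filter.eventually_atTop.mpr ⟨_, hfin⟩)

/-! ### Upper bound for `S(d)` and the limit `ε_n → 0` -/

/-- `S(d) ≤ 2 C_n D^s` (from `R((m+1)/d) ≤ C_n d^s/(m+1)^s ≤ 2 C_n d^s (1/(m+1) - 1/(m+2))`).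
[folklore] -/
theorem S_le (hD : 0 < D) {d : ℕ} (hd : d ∣ D) (hr : 1 ≤ r) (hs : (2 * r + 1) * D + 2 ≤ s + 1) :
    S r D s n d ≤ 2 * Cn r D s n * (D : ℝ) ^ s := by
  have hd0 : 0 < d := Nat.pos_of_dvd_of_pos hd hD
  have hd' : (0 : ℝ) < d := by exact_mod_cast hd0
  have hd1 : (1 : ℝ) ≤ d := by exact_mod_cast hd0
  have hdD : (d : ℝ) ≤ D := by exact_mod_cast Nat.le_of_dvd hD hd
  have hC := Cn_pos (D := D) (s := s) (n := n) hD hr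
  have hs2 : 2 ≤ s := one_lt_s hD hs
  set c := Cn r D s n * (d : ℝ) ^ s with hc
  have hc0 : 0 ≤ c := by positivity
  -- termwise: `term m ≤ 2c (1/(m+1) - 1/(m+2))`
  have hterm : ∀ m : ℕ, term r D s n d m ≤ 2 * c * (1 / ((m : ℝ) + 1) - 1 / ((m : ℝ) + 2)) := by
    intro m
    have h1 := term_le (n := n) hD hd hr hs m
    have hm1 : (1 : ℝ) ≤ (m : ℝ) + 1 := by
      have : (0 : ℝ) ≤ m := Nat.cast_nonneg m
      linarith
    have h2 : c / ((m : ℝ) + 1) ^ s ≤ c / ((m : ℝ) + 1) ^ 2 :=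
      div_le_div_of_nonneg_left hc0 (by positivity) (pow_le_pow_right₀ hm1 hs2)
    have h3 : 1 / ((m : ℝ) + 1) ^ 2 ≤ 2 * (1 / ((m : ℝ) + 1) - 1 / ((m : ℝ) + 2)) := by
      have hm0 : (0 : ℝ) ≤ m := Nat.cast_nonneg m
      rw [show (2 : ℝ) * (1 / ((m : ℝ) + 1) - 1 / ((m : ℝ) + 2)) =
        2 / (((m : ℝ) + 1) * ((m : ℝ) + 2)) by field_simp; ring]
      rw [div_le_div_iff₀ (by positivity) (by positivity)]
      nlinarith
    calc term r D s n d m ≤ c / ((m : ℝ) + 1) ^ s := by rw [hc]; exact h1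
      _ ≤ c / ((m : ℝ) + 1) ^ 2 := h2
      _ = c * (1 / ((m : ℝ) + 1) ^ 2) := by ring
      _ ≤ c * (2 * (1 / ((m : ℝ) + 1) - 1 / ((m : ℝ) + 2))) := mul_le_mul_of_nonneg_left h3 hc0
      _ = 2 * c * (1 / ((m : ℝ) + 1) - 1 / ((m : ℝ) + 2)) := by ring
  have hpartial : ∀ N : ℕ, ∑ m ∈ range N, term r D s n d m ≤ 2 * c := by
    intro N
    have htel : ∑ m ∈ range N, (1 / ((m : ℝ) + 1) - 1 / ((m : ℝ) + 2)) = 1 - 1 / ((N : ℝ) + 1) := by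
      have h := Finset.sum_range_sub' (fun m : ℕ => 1 / ((m : ℝ) + 1)) N
      have e : ∀ m : ℕ, (1 : ℝ) / ((m : ℝ) + 2) = 1 / (((m + 1 : ℕ) : ℝ) + 1) := by
        intro m; push_cast; ring
      simp_rw [e]
      rw [h]
      simp
    calc ∑ m ∈ range N, term r D s n d m
        ≤ ∑ m ∈ range N, 2 * c * (1 / ((m : ℝ) + 1) - 1 / ((m : ℝ) + 2)) := sum_le_sum fun m _ => hterm m
      _ = 2 * c * (1 - 1 / ((N : ℝ) + 1)) := by rw [← mul_sum, htel]
      _ ≤ 2 * c := by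
          have : 0 ≤ 1 / ((N : ℝ) + 1) := by positivity
          nlinarith
  have htsum : ∑' m, term r D s n d m ≤ 2 * c :=
    Real.tsum_le_of_sum_range_le (term_nonneg hD hd) hpartial
  unfold S
  rw [div_le_iff₀ hd']
  calc ∑' m, term r D s n d m ≤ 2 * c := htsum
    _ = 2 * Cn r D s n * (d : ℝ) ^ s * 1 := by rw [hc]; ring
    _ ≤ 2 * Cn r D s n * (D : ℝ) ^ s * d := by
        gcongr

/-- `c₂ ≤ (((2r+1)D+1)K² + 2(s+1))/n` for `n ≥ K ≥ 1`. [folklore] -/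
theorem c₂_le {K : ℕ} (hr : 1 ≤ r) (hK : 0 < K) (hn : K ≤ n) :
    c₂ r D s n K ≤ (((((2 * r + 1) * D : ℕ) : ℝ) + 1) * (K : ℝ) ^ 2 + 2 * ((s : ℝ) + 1)) / n := by
  have hK' : (0 : ℝ) < K := by exact_mod_cast hK
  have hn1 : (1 : ℝ) ≤ n := by
    have h1 : (K : ℝ) ≤ n := by exact_mod_cast hn
    have h2 : (1 : ℝ) ≤ K := by exact_mod_cast hK
    linarith
  have hn0 : (0 : ℝ) < n := by linarith
  have hu : (n : ℝ) / K < (uu n K : ℕ) := by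
    unfold uu; push_cast; exact div_lt_floor_add_one hK
  have hu0 : (0 : ℝ) < (n : ℝ) / K := by positivity
  have hT₀ : (n : ℝ) ≤ (T₀ r n K : ℕ) := by
    unfold T₀; push_cast
    have : (0 : ℝ) ≤ (uu n K : ℕ) := by positivity
    have hr1 : (1 : ℝ) ≤ r := by exact_mod_cast hr
    nlinarith
  have hL : (Lnum r D n : ℝ) + 1 ≤ ((((2 * r + 1) * D : ℕ) : ℝ) + 1) * n := by
    unfold Lnum; push_cast; nlinarith
  have hB0 : (0 : ℝ) ≤ (((2 * r + 1) * D : ℕ) : ℝ) + 1 := by positivity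
  have h1 : ((Lnum r D n : ℝ) + 1) / ((uu n K : ℕ) : ℝ) ^ 2 ≤
      ((((2 * r + 1) * D : ℕ) : ℝ) + 1) * (K : ℝ) ^ 2 / n := by
    have hu2 : ((n : ℝ) / K) ^ 2 ≤ ((uu n K : ℕ) : ℝ) ^ 2 := pow_le_pow_left₀ hu0.le hu.le 2
    calc ((Lnum r D n : ℝ) + 1) / ((uu n K : ℕ) : ℝ) ^ 2
        ≤ ((Lnum r D n : ℝ) + 1) / ((n : ℝ) / K) ^ 2 :=
          div_le_div_of_nonneg_left (by positivity) (by positivity) hu2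
      _ ≤ (((((2 * r + 1) * D : ℕ) : ℝ) + 1) * n) / ((n : ℝ) / K) ^ 2 :=
          div_le_div_of_nonneg_right hL (by positivity)
      _ = ((((2 * r + 1) * D : ℕ) : ℝ) + 1) * (K : ℝ) ^ 2 / n := by field_simp
  have h2 : ((s : ℝ) + 1) * ((n : ℝ) + 1) / ((T₀ r n K : ℕ) : ℝ) ^ 2 ≤ 2 * ((s : ℝ) + 1) / n := by
    have hT2 : (n : ℝ) ^ 2 ≤ ((T₀ r n K : ℕ) : ℝ) ^ 2 := pow_le_pow_left₀ hn0.le hT₀ 2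
    have hnumle : ((s : ℝ) + 1) * ((n : ℝ) + 1) ≤ 2 * ((s : ℝ) + 1) * n := by
      have : (0 : ℝ) ≤ (s : ℝ) + 1 := by positivity
      nlinarith
    calc ((s : ℝ) + 1) * ((n : ℝ) + 1) / ((T₀ r n K : ℕ) : ℝ) ^ 2
        ≤ ((s : ℝ) + 1) * ((n : ℝ) + 1) / (n : ℝ) ^ 2 :=
          div_le_div_of_nonneg_left (by positivity) (by positivity) hT2
      _ ≤ (2 * ((s : ℝ) + 1) * n) / (n : ℝ) ^ 2 := div_le_div_of_nonneg_right hnumle (by positivity)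
      _ = 2 * ((s : ℝ) + 1) / n := by field_simp
  unfold c₂
  rw [show (((((2 * r + 1) * D : ℕ) : ℝ) + 1) * (K : ℝ) ^ 2 + 2 * ((s : ℝ) + 1)) / n =
    ((((2 * r + 1) * D : ℕ) : ℝ) + 1) * (K : ℝ) ^ 2 / n + 2 * ((s : ℝ) + 1) / n by ring]
  exact add_le_add h1 h2

/-- `ε_n → 0`. [folklore] -/
theorem tendsto_ε {K : ℕ} (hr : 1 ≤ r) (hK : 0 < K) :
    Filter.Tendsto (fun n => ε r D s n K) Filter.atTop (nhds 0) := by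
  -- `e^{-u} → 0`
  have hu : Filter.Tendsto (fun n => ((uu n K : ℕ) : ℝ)) Filter.atTop Filter.atTop := by
    refine Filter.tendsto_atTop_mono (fun n => (div_lt_floor_add_one (n := n) hK).le |>.trans
      (le_of_eq (by unfold uu; push_cast; ring))) ?_
    exact Filter.Tendsto.atTop_div_const (by exact_mod_cast hK) tendsto_natCast_atTop_atTop
  have h1 : Filter.Tendsto (fun n => Real.exp (-((uu n K : ℕ) : ℝ))) Filter.atTop (nhds 0) :=
    Real.tendsto_exp_neg_atTop_nhds_zero.comp hu
  -- `√c₂ → 0`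
  have h2 : Filter.Tendsto (fun n => c₂ r D s n K) Filter.atTop (nhds 0) := by
    have hlim : Filter.Tendsto (fun n : ℕ =>
        (((((2 * r + 1) * D : ℕ) : ℝ) + 1) * (K : ℝ) ^ 2 + 2 * ((s : ℝ) + 1)) / n)
        Filter.atTop (nhds 0) := tendsto_const_div_atTop_nhds_zero_nat _
    refine tendsto_of_tendsto_of_tendsto_of_le_of_le' tendsto_const_nhds hlim ?_ ?_
    · exact Filter.Eventually.of_forall fun n => (c₂_pos r D s n K).le
    · filter_upwards [Filter.eventually_ge_atTop K] with n hn
      exact c₂_le hr hK hn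
  have h3 := h2.sqrt
  rw [Real.sqrt_zero] at h3
  have := h1.add h3
  rw [add_zero] at this
  exact this.congr fun _ => rfl

/-- **Main sampling theorem.** Under the window condition, for every `θ > 0`, for all large `n`:
`|S(d) - S(d')| ≤ θ S(D)` for all divisors `d, d'` of `D`. [folklore] -/
theorem eventually_abs_S_sub_S_le {K : ℕ} (hD : 0 < D) (hr : 1 ≤ r) (hs : (2 * r + 1) * D + 2 ≤ s + 1)
    (hK : 0 < K) (hwin : 1 + 2 * ((s : ℝ) + 1) / r ≤ D * Real.log ((r : ℝ) * K / 6))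
    {θ : ℝ} (hθ : 0 < θ) :
    ∀ᶠ n in Filter.atTop, ∀ d d' : ℕ, d ∣ D → d' ∣ D →
      |S r D s n d - S r D s n d'| ≤ θ * S r D s n D := by
  have hε := tendsto_ε (D := D) (s := s) hr hK
  have hpos : 0 < min (1 / 2) (θ / 4) := lt_min (by norm_num) (by linarith)
  filter_upwards [Filter.eventually_ge_atTop K, hε.eventually (Iic_mem_nhds hpos)] with n hn hn'
  intro d d' hd hd'
  have hle : ε r D s n K ≤ min (1 / 2) (θ / 4) := hn'
  have h := abs_S_sub_S_le hD hr hs hK hn hwin (hle.trans (min_le_left _ _)) hd hd'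
  have hS := S_nonneg (r := r) (s := s) (n := n) hD (dvd_refl D)
  have : 4 * ε r D s n K ≤ θ := by linarith [hle.trans (min_le_right _ _)]
  nlinarith

end OddZetaSampling

end Literature.NumberTheory.Transcendental
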